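import Literature.MathematicalPhysics.QuantumFieldTheory.Balaban1983to89.B9Thm37GlueSt
import Literature.MathematicalPhysics.QuantumFieldTheory.Balaban1983to89.B9Thm37GlueCor36

/-!
# B9Thm37GlueSz — from the POINTWISE sizes of ∂h_□, Δh_□ to the located kernel hypotheses of the lineage:
print's silent step «(3.42) for G′_□ ⇒ (3.89)» (sibling leaf of `B9Thm37GlueSt` v2; cell record D-pv21g6.3)

[B9] T. Bałaban, *Propagators for lattice gauge theories in a background field*, Commun. Math. Phys. **99** (1985)
389–434 [cite: Balaban1985BackgroundPropagators]; [4] = T. Bałaban, *Propagators and renormalization transformations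
for lattice gauge theories. II*, Commun. Math. Phys. **96** (1984) 223–250 [cite: Balaban1984PropagatorsII].

p. 409 (verbatim, the sentences after (3.88); render p021-x2 read as image — the text layer garbles the exponent):
*"Using the inequalities (3.42) for G′_□, we get the bound |(K(h_□)G′_□h_□λ)(x)| ≦ O(M^{−1})e^{−δ₀(L^jη)^{−1}|y−y′|}|λ|
(3.89) for x∈Δ(y), supp λ ⊂ Δ(y′), y, y′∈□∈𝒟_j. It is exactly the bound (2.44) of [4], rescaled to η-scale. This
bound was a basis of all the remaining considerations in that paper, connected with the convergence of the expansion
(2.50), so we may apply them here also."*; [4] p. 229 (verbatim, render p007-x2): *"We construct also the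
corresponding family of functions h described in (1.118), and rescale them to proper scales. They satisfy
Σ_{□∈𝒟} h²_□ = 1. (2.36)"*; [4] p. 230 (verbatim, render p008-x2, after (2.43)): *"This inequality and (2.40) imply
|(K(h_□)G′(□)h_□λ)(x)| ≦ O(M^{−1})e^{−δ₀|x−y|}|λ| (2.44) if either supp λ ⊂ B^j(y) for y∈Λ_j, or supp λ ⊂ B^{j+1}(y)
for y∈Λ_{j+1}. The distance in the above inequality is measured on L^{−j}-scale."*.

v2 (APPEND-ONLY §6, same unit, journal claim HOM-389-SZ-V2; one import added: `…B9Thm37GlueCor36`): the inputs h342_1, h342_2, h342_3, h342_4 of the §3 entry theorems, in their literal FAMILY form over the partition index (one local operator G′_□ per cube), are delivered with ONE pair (B₀, δ₀) from the cell's typed Corollary 3.6 (`B9.Cor36Printed`, b09 lineage) through `B9Thm37GlueCor36.h342_of_cor36_joint` (GlueCor36 v4R, c779536ec044) and r1-g11's reading hypothesis `B9SectCDiffDict.Realizes` (`h342_family_of_cor36`; print p. 409: "The operators constructed for this sequence, which we denote by G′_□(U), … satisfy all the inequalities of Theorems 3.1–3.3 correspondingly").  Corollary 3.6 is NOT asserted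 (hypothesis); the printed provisos M ≧ M₁, O(1)Mα₀ ≦ a₁, (3.35), "Ω′₀ ⊂ □ for a cube □ of the class described" (`InCube`) are displayed.

THE POINT.  Print passes from the bounds (3.42) for the local operators G′_□ to (3.89) in one sentence; the sizes of
the coefficients (∂h_□)(b), (Δh_□)(x) of K(h_□) ((3.88); [4] (2.40)) — O((ML^jη)^{−1}), O((ML^jη)^{−2}) on the support
of h_□ for the rescaled profiles of (1.118)/(2.36) — and the counting of bonds and blocks near a point are used
silently.  The `B9Thm37Glue` lineage models this step by BLOCK MAJORANTS: `B9Thm37GlueSt` (v1/v2) derives the four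
entries of (3.42) for G′ from Corollary 3.6 for the G′_□ under LOCATED KERNEL HYPOTHESES — for every □ a star kernel
K_{S,□} dominating the (∂h_□)-coefficients blockwise (`hdomSt`, `hdhSt`, `hdomT`, `hdh`) with row / column sums
≦ κ1_{S′_□} against the weight L^{j″}η, and a diagonal kernel K_{Δ,□} dominating (Δh_□) (`hdiag`) with sums ≦ κ1_{S′_□}
against (L^{j″}η)².  THIS FILE discharges those kernel hypotheses from POINTWISE data, the shape in which print's
(1.118)/(2.36) speak: for each □ a number θ_□ with |c(b)(h_□(b₊) − h_□(b₋))| ≦ θ_□ for every bond (θ_□ = O((ML^jη)^{−1})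
in print, NOT asserted), a number θ_{2,□} with |(Δh_□)(x)| ≦ θ_{2,□} (O((ML^jη)^{−2}), NOT asserted), the located
support of ∂h_□ (every block met by a bond b with h_□(b₊) ≠ h_□(b₋) lies in S′_□: `hsupp`), entries of the
orthogonal matrices R(U(b)) bounded by 1 (`hR1`, DERIVED from the orthogonality `hRm` in §3: `abs_Rm_le_one`), at
most N_d bonds starting resp. ending at a lattice point (`hNs`, `hNt`; in print d each — st(x) has 2d bonds,
(3.50)) and the adjacency of the block of a bond component to the blocks of its endpoints (`hadj`, within the
localisation radius ρ).  The kernels are then CANONICAL: the located indicator kernel `indK S′_□ ρ θ_□` (θ_□ on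
S′_□ × S′_□ ∩ {d ≦ ρ}, 0 elsewhere) times a counting constant, and the diagonal kernel `diagK S′_□ θ_{2,□}`; their
row / column sums are θ_□ × (a local VOLUME of S′_□: Σ of L^{j″}η over the blocks of S′_□ within ρ of a given block,
resp. their number times L^{j″}η) and θ_{2,□}(L^{j″}η)² — products which print's geometry makes O(M^{−1}), O(M^{−2})
(θ_□ = O((ML^jη)^{−1}) against boundedly many blocks within ρ, each of size L^{j″}η ≦ L·L^jη; θ_{2,□}(L^{j″}η)² ≦
O((ML^jη)^{−2})(L·L^jη)²) and which enter here as the HYPOTHESES `hV₁`, `hV₂`, `hV₃`, `hC₁` bounding them by numbers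
v₁, v₂, κ₄, w₁ (NOT asserted: the cell has no typed model of the multi-scale cube family 𝒟 of [4] p. 229).

CONTENTS.  §1 `indK`, `diagK` and their row / column sums (`rowSum_indK`, `colSum_indK`, `rowSum_diagK`,
`colSum_diagK`; kernel facts).  §2 pointwise sizes ⇒ dominations: `indK_eq_of_dh_ne`, `domT_of_size` (⇒ `hdomT`),
`domSt_of_size` (⇒ `hdomSt`), `dh_of_size` (⇒ `hdh`), `dhSt_of_size` (⇒ `hdhSt`), `slap_eq_zero_of_far`,
`diag_of_size` (⇒ `hdiag`).  §3 **Theorem 3.7 ⇒ the four entries of (3.42) for G′ with (3.88) DERIVED in the printed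
grouping and the ∂h_□ / Δh_□ kernels DISCHARGED from pointwise sizes**: `thm37_entry4_of_342_lattice_of_387_sz`,
`thm37_entry2_of_342_lattice_of_387_sz`, `thm37_entry1_of_342_lattice_of_387_sz`, `thm37_entry3_of_342_lattice_of_387_sz`
(= the `_st` theorems of `B9Thm37GlueSt` with K_S := (N_d + N_d·#Cp)·indK, K_Δ := diagK, K_{C′} := indK resp.
N_d·indK, K_P := (1 + #Cp)·indK).  §4 the volume products v₁, κ₄, w₁ of `hV₁`, `hV₃`, `hC₁` from PRIMITIVE print-shaped bounds
(`vol₁_of_prim`, `vol₃_of_prim`, `col₁_of_prim`): θ_□ × block length ≦ t (print O(M^{−1}): (1.118)/(2.36)), ≦ N_ρ blocks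
of S′_□ within ρ of a block, comparability C_ℓ of block lengths — all three hypotheses, NOT asserted.  §5 the
transposition hypothesis `hGt` of entry 3 (symmetry of G′_□) as folklore linear algebra: right inverses of a
transpose pair form a transpose pair (`isTransposePair_of_rightInverse`, `isTransposePair_inv`), the Dirichlet
sandwich M_χTM_χ + M_{χ′} of a symmetric T is symmetric (`isTransposePair_sandwich`), hence every inverse of the
sandwiched symmetric Δ′_a is symmetric (`isTransposePair_dirichletInverse` — the shape of `hGt`; invertibility NOT
asserted).  (The Q-part analogues — within-block oscillation of h_□ from the per-bond bound, and the ℓ¹ sizes of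
Q′ from a pointwise bound — live in `B9Thm37GlueQ` §8–§11, which does not import this chain.)

NOT ASSERTED (hypotheses, as in `B9Thm37GlueSt` unless new): the sizes θ_□, θ_{2,□} and the volume products v₁, v₂,
κ₄, w₁ (print: O(M^{−1}), O(M^{−2}) — (1.118)/(2.36) and the geometry of 𝒟, not displayed); `hsupp`, `hadj`, `hNs`,
`hNt` (model data); orthogonality `hRm` (⇒ |R_{ki}| ≦ 1); Corollary 3.6 for the G′_□ (`h342_*`); `hloc`, `hsq`, `hinv`; Q =
Q′*aQ′ abstract with commutator majorant `hQ` (kernel K_Q, sums κ_Q — obtainable from a block majorant of Q and an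
oscillation bound of h_□ by the sibling leaf `B9Thm37GlueQ.commData_of_osc`, not imported here) and, for entry 3,
`hQt`, `hG`, `hcomp`;
partition data; Lemma 2.1 of [4] (`h261`, `h263`); geometry; located smallness.  Value: kernel-checked bookkeeping
(the counting behind one printed sentence), NOT summit progress.
-/

namespace Literature.MathematicalPhysics.QuantumFieldTheory.Balaban1983to89.B9Thm37GlueSz

open Literature.MathematicalPhysics.QuantumFieldTheory.Balaban1983to89
open Finset B6RandomWalk B6RandomWalkHom B9Thm37Sum B9Thm34Ext B9Thm37Glue B9Thm37GlueT B9Thm37GlueSt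

variable {g : B9.Geometry} [Fintype g.Site] [DecidableEq g.Site] {R : ℝ} {H : Prop} {St Cp Bd : Type}

/-! ## §1  The canonical located kernels -/

section Kernels

/-- MODEL. **The located indicator kernel**: θ on S′ × S′ ∩ {d(a, y) ≦ ρ}, 0 elsewhere. [folklore] -/
noncomputable def indK (S' : Finset g.Site) (ρ θ : ℝ) (a y : g.Site) : ℝ :=
  if a ∈ S' ∧ y ∈ S' ∧ g.dist a y ≤ ρ then θ else 0

/-- MODEL. **The located diagonal kernel**: θ on the diagonal of S′, 0 elsewhere. [folklore] -/
def diagK (S' : Finset g.Site) (θ : ℝ) (a y : g.Site) : ℝ :=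
  if a ∈ S' ∧ a = y then θ else 0

omit [Fintype g.Site] in
/-- `indK ≥ 0` for θ ≥ 0. [folklore] -/
theorem indK_nonneg {S' : Finset g.Site} {ρ θ : ℝ} (hθ : 0 ≤ θ) (a y : g.Site) : 0 ≤ indK S' ρ θ a y := by
  unfold indK
  split_ifs
  · exact hθ
  · exact le_rfl

omit [Fintype g.Site] in
/-- `indK` is localised within ρ. [folklore] -/
theorem indK_loc {S' : Finset g.Site} {ρ θ : ℝ} {a y : g.Site} (h : indK S' ρ θ a y ≠ 0) : g.dist a y ≤ ρ := by
  unfold indK at h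
  by_contra hc
  exact h (if_neg fun hh => hc hh.2.2)

omit [Fintype g.Site] in
/-- The value of `indK` on its support. [folklore] -/
theorem indK_eq_of_mem {S' : Finset g.Site} {ρ θ : ℝ} {a y : g.Site} (ha : a ∈ S') (hy : y ∈ S')
    (hd : g.dist a y ≤ ρ) : indK S' ρ θ a y = θ :=
  if_pos ⟨ha, hy, hd⟩

/-- **Row sums of the indicator kernel against a weight** = θ × the local volume of S′ (located on S′). [folklore] -/
theorem rowSum_indK (S' : Finset g.Site) (ρ θ : ℝ) (w : g.Site → ℝ) (a : g.Site) :
    ∑ y, indK S' ρ θ a y * w y =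
      if a ∈ S' then θ * ∑ y ∈ S'.filter (fun y => g.dist a y ≤ ρ), w y else 0 := by
  unfold indK
  by_cases ha : a ∈ S'
  · rw [if_pos ha]
    calc ∑ y, (if a ∈ S' ∧ y ∈ S' ∧ g.dist a y ≤ ρ then θ else 0) * w y
        = ∑ y, (if y ∈ S' then (if g.dist a y ≤ ρ then θ * w y else 0) else 0) := by
          refine Finset.sum_congr rfl fun y _ => ?_
          by_cases hy : y ∈ S'
          · by_cases hd : g.dist a y ≤ ρ
            · rw [if_pos ⟨ha, hy, hd⟩, if_pos hy, if_pos hd]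
            · rw [if_neg fun hh => hd hh.2.2, if_pos hy, if_neg hd, zero_mul]
          · rw [if_neg fun hh => hy hh.2.1, if_neg hy, zero_mul]
      _ = ∑ y ∈ S', (if g.dist a y ≤ ρ then θ * w y else 0) := by
          rw [Finset.sum_ite_mem, Finset.univ_inter]
      _ = θ * ∑ y ∈ S'.filter (fun y => g.dist a y ≤ ρ), w y := by
          rw [Finset.mul_sum, Finset.sum_filter]
  · rw [if_neg ha]
    exact Finset.sum_eq_zero fun y _ => by rw [if_neg fun hh => ha hh.1, zero_mul]

/-- **Column sums of the indicator kernel** = θ × the local block count of S′ (located on S′). [folklore] -/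
theorem colSum_indK (S' : Finset g.Site) (ρ θ : ℝ) (b : g.Site) :
    ∑ y, indK S' ρ θ y b = if b ∈ S' then θ * ((S'.filter (fun y => g.dist y b ≤ ρ)).card : ℝ) else 0 := by
  unfold indK
  by_cases hb : b ∈ S'
  · rw [if_pos hb]
    calc ∑ y, (if y ∈ S' ∧ b ∈ S' ∧ g.dist y b ≤ ρ then θ else 0)
        = ∑ y, (if y ∈ S' then (if g.dist y b ≤ ρ then θ else 0) else 0) := by
          refine Finset.sum_congr rfl fun y _ => ?_
          by_cases hy : y ∈ S'
          · by_cases hd : g.dist y b ≤ ρ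
            · rw [if_pos ⟨hy, hb, hd⟩, if_pos hy, if_pos hd]
            · rw [if_neg fun hh => hd hh.2.2, if_pos hy, if_neg hd]
          · rw [if_neg fun hh => hy hh.1, if_neg hy]
      _ = ∑ y ∈ S', (if g.dist y b ≤ ρ then θ else 0) := by
          rw [Finset.sum_ite_mem, Finset.univ_inter]
      _ = θ * ((S'.filter (fun y => g.dist y b ≤ ρ)).card : ℝ) := by
          rw [← Finset.sum_filter, Finset.sum_const, nsmul_eq_mul, mul_comm]
  · rw [if_neg hb]
    exact Finset.sum_eq_zero fun y _ => by rw [if_neg fun hh => hb hh.2.1]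

omit [Fintype g.Site] in
/-- `diagK ≥ 0` for θ ≥ 0. [folklore] -/
theorem diagK_nonneg {S' : Finset g.Site} {θ : ℝ} (hθ : 0 ≤ θ) (a y : g.Site) : 0 ≤ diagK S' θ a y := by
  unfold diagK
  split_ifs
  · exact hθ
  · exact le_rfl

omit [Fintype g.Site] in
/-- `diagK` is localised within any ρ ≥ 0 (d(y, y) = 0). [folklore] -/
theorem diagK_loc {S' : Finset g.Site} {θ ρ : ℝ} (hrefl : ∀ y : g.Site, g.dist y y = 0) (hρ : 0 ≤ ρ)
    {a y : g.Site} (h : diagK S' θ a y ≠ 0) : g.dist a y ≤ ρ := by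
  unfold diagK at h
  by_cases hc : a ∈ S' ∧ a = y
  · rw [← hc.2, hrefl]
    exact hρ
  · exact absurd (if_neg hc) h

/-- Row sums of the diagonal kernel. [folklore] -/
theorem rowSum_diagK (S' : Finset g.Site) (θ : ℝ) (w : g.Site → ℝ) (a : g.Site) :
    ∑ y, diagK S' θ a y * w y = if a ∈ S' then θ * w a else 0 := by
  unfold diagK
  by_cases ha : a ∈ S'
  · rw [if_pos ha, Finset.sum_eq_single a]
    · rw [if_pos ⟨ha, rfl⟩]
    · intro y _ hy
      rw [if_neg fun hh => hy hh.2.symm, zero_mul]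
    · intro h
      exact absurd (Finset.mem_univ a) h
  · rw [if_neg ha]
    exact Finset.sum_eq_zero fun y _ => by rw [if_neg fun hh => ha hh.1, zero_mul]

/-- Column sums of the diagonal kernel. [folklore] -/
theorem colSum_diagK (S' : Finset g.Site) (θ : ℝ) (b : g.Site) :
    ∑ y, diagK S' θ y b = if b ∈ S' then θ else 0 := by
  unfold diagK
  rw [Finset.sum_eq_single b]
  · by_cases hb : b ∈ S'
    · rw [if_pos ⟨hb, rfl⟩, if_pos hb]
    · rw [if_neg fun hh => hb hh.1, if_neg hb]
  · intro y _ hy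
    exact if_neg fun hh => hy hh.2
  · intro h
    exact absurd (Finset.mem_univ b) h

end Kernels

/-! ## §2  Pointwise sizes ⇒ the located dominations of `B9Thm37GlueSt` -/

section Dominations

variable [Fintype Bd] [Fintype Cp] [DecidableEq St]

omit [Fintype g.Site] [DecidableEq g.Site] [Fintype Bd] [DecidableEq St] in
/-- The entries of an orthogonal matrix are bounded by 1 (Σ_k R_{ki}² = 1) — so `hR1` below follows from the
orthogonality hypothesis `hRm` of `B9Thm37GlueSt`. [folklore] -/
theorem abs_Rm_le_one (Rm : Bd → Cp → Cp → ℝ) [DecidableEq Cp]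
    (hRm : ∀ b i j, ∑ k, Rm b k i * Rm b k j = if i = j then 1 else 0) (b : Bd) (k i : Cp) :
    |Rm b k i| ≤ 1 := by
  have h1 : ∑ k', Rm b k' i * Rm b k' i = 1 := by rw [hRm b i i, if_pos rfl]
  have h2 : Rm b k i * Rm b k i ≤ ∑ k', Rm b k' i * Rm b k' i :=
    Finset.single_le_sum (f := fun k' => Rm b k' i * Rm b k' i) (fun k' _ => mul_self_nonneg _)
      (Finset.mem_univ k)
  rw [h1] at h2
  exact abs_le_one_iff_mul_self_le_one.mpr h2

omit [Fintype g.Site] [Fintype Bd] [Fintype Cp] [DecidableEq St] in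
/-- On a bond where h jumps, the indicator kernel takes the value θ between the block of any component of the
bond and the block of any component of either endpoint (located support `hsupp` + adjacency `hadj`). [folklore] -/
theorem indK_eq_of_dh_ne {S' : Finset g.Site} {ρ θ : ℝ} (blk : St × Cp → g.Site) (blkY : Bd × Cp → g.Site)
    (src tgt : Bd → St) (h : St → ℝ)
    (hsupp : ∀ b, h (tgt b) ≠ h (src b) →
      (∀ i, blk (src b, i) ∈ S' ∧ blk (tgt b, i) ∈ S') ∧ ∀ k, blkY (b, k) ∈ S')
    (hadj : ∀ b i k, g.dist (blk (src b, i)) (blkY (b, k)) ≤ ρ ∧ g.dist (blk (tgt b, i)) (blkY (b, k)) ≤ ρ ∧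
      g.dist (blkY (b, k)) (blk (src b, i)) ≤ ρ ∧ g.dist (blkY (b, k)) (blk (tgt b, i)) ≤ ρ)
    {b : Bd} (hd : h (tgt b) ≠ h (src b)) (i k : Cp) :
    indK S' ρ θ (blk (src b, i)) (blkY (b, k)) = θ ∧ indK S' ρ θ (blk (tgt b, i)) (blkY (b, k)) = θ ∧
      indK S' ρ θ (blkY (b, k)) (blk (src b, i)) = θ ∧ indK S' ρ θ (blkY (b, k)) (blk (tgt b, i)) = θ := by
  obtain ⟨hsb, hYb⟩ := hsupp b hd
  obtain ⟨h1, h2, h3, h4⟩ := hadj b i k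
  exact ⟨indK_eq_of_mem (hsb i).1 (hYb k) h1, indK_eq_of_mem (hsb i).2 (hYb k) h2,
    indK_eq_of_mem (hYb k) (hsb i).1 h3, indK_eq_of_mem (hYb k) (hsb i).2 h4⟩

omit [Fintype g.Site] [Fintype Cp] in
/-- **Pointwise size ⇒ `hdomT`**: the (∂h)-coefficients over the bonds STARTING at a site component and landing in
the bond block y′ are dominated by N_d·indK (at most N_d bonds start at a point). [cite: Balaban1985BackgroundPropagators, (3.88)–(3.89) p.409] -/
theorem domT_of_size {S' : Finset g.Site} {ρ θ : ℝ} (blk : St × Cp → g.Site) (blkY : Bd × Cp → g.Site)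
    (src tgt : Bd → St) (c : Bd → ℝ) (h : St → ℝ) (Nd : ℕ) (hθ0 : 0 ≤ θ)
    (hθ : ∀ b, |c b * (h (tgt b) - h (src b))| ≤ θ)
    (hNs : ∀ x : St, (Finset.univ.filter (fun b => src b = x)).card ≤ Nd)
    (hsupp : ∀ b, h (tgt b) ≠ h (src b) →
      (∀ i, blk (src b, i) ∈ S' ∧ blk (tgt b, i) ∈ S') ∧ ∀ k, blkY (b, k) ∈ S')
    (hadj : ∀ b i k, g.dist (blk (src b, i)) (blkY (b, k)) ≤ ρ ∧ g.dist (blk (tgt b, i)) (blkY (b, k)) ≤ ρ ∧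
      g.dist (blkY (b, k)) (blk (src b, i)) ≤ ρ ∧ g.dist (blkY (b, k)) (blk (tgt b, i)) ≤ ρ)
    (x : St) (i : Cp) (y' : g.Site) :
    ∑ b ∈ Finset.univ.filter (fun b => src b = x ∧ blkY (b, i) = y'), |c b * (h (tgt b) - h (src b))| ≤
      Nd * indK S' ρ θ (blk (x, i)) y' := by
  have hK0 : 0 ≤ indK S' ρ θ (blk (x, i)) y' := indK_nonneg hθ0 _ _
  calc ∑ b ∈ Finset.univ.filter (fun b => src b = x ∧ blkY (b, i) = y'), |c b * (h (tgt b) - h (src b))|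
      ≤ ((Finset.univ.filter (fun b => src b = x ∧ blkY (b, i) = y')).card : ℝ) * indK S' ρ θ (blk (x, i)) y' := by
        rw [← nsmul_eq_mul]
        refine Finset.sum_le_card_nsmul _ _ _ fun b hb => ?_
        simp only [Finset.mem_filter, Finset.mem_univ, true_and] at hb
        obtain ⟨hb1, hb2⟩ := hb
        by_cases hd : h (tgt b) = h (src b)
        · rw [hd, sub_self, mul_zero, abs_zero]
          exact hK0
        · obtain ⟨e1, -, -, -⟩ := indK_eq_of_dh_ne (θ := θ) blk blkY src tgt h hsupp hadj hd i i
          rw [hb1, hb2] at e1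
          rw [e1]
          exact hθ b
    _ ≤ Nd * indK S' ρ θ (blk (x, i)) y' := by
        refine mul_le_mul_of_nonneg_right ?_ hK0
        have hc : (Finset.univ.filter (fun b => src b = x ∧ blkY (b, i) = y')).card ≤
            (Finset.univ.filter (fun b => src b = x)).card :=
          Finset.card_le_card fun b hb => by
            simp only [Finset.mem_filter, Finset.mem_univ, true_and] at hb ⊢
            exact hb.1
        exact_mod_cast hc.trans (hNs x)

omit [Fintype g.Site] in
/-- **Pointwise size ⇒ `hdomSt`**: the star sum of `B9Thm37GlueSt.leibRemSt_majorant` (bonds starting at the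
site component and landing in y′, plus the R-transported bonds ending at it) is dominated by (N_d + N_d·#Cp)·indK.
[cite: Balaban1985BackgroundPropagators, (3.88)–(3.89) p.409 + (3.50) p.400] -/
theorem domSt_of_size {S' : Finset g.Site} {ρ θ : ℝ} (blk : St × Cp → g.Site) (blkY : Bd × Cp → g.Site)
    (src tgt : Bd → St) (c : Bd → ℝ) (Rm : Bd → Cp → Cp → ℝ) (h : St → ℝ) (Nd : ℕ) (hθ0 : 0 ≤ θ)
    (hθ : ∀ b, |c b * (h (tgt b) - h (src b))| ≤ θ) (hR1 : ∀ b k i, |Rm b k i| ≤ 1)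
    (hNs : ∀ x : St, (Finset.univ.filter (fun b => src b = x)).card ≤ Nd)
    (hNt : ∀ x : St, (Finset.univ.filter (fun b => tgt b = x)).card ≤ Nd)
    (hsupp : ∀ b, h (tgt b) ≠ h (src b) →
      (∀ i, blk (src b, i) ∈ S' ∧ blk (tgt b, i) ∈ S') ∧ ∀ k, blkY (b, k) ∈ S')
    (hadj : ∀ b i k, g.dist (blk (src b, i)) (blkY (b, k)) ≤ ρ ∧ g.dist (blk (tgt b, i)) (blkY (b, k)) ≤ ρ ∧
      g.dist (blkY (b, k)) (blk (src b, i)) ≤ ρ ∧ g.dist (blkY (b, k)) (blk (tgt b, i)) ≤ ρ)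
    (x : St) (i : Cp) (y' : g.Site) :
    (∑ b ∈ Finset.univ.filter (fun b => src b = x ∧ blkY (b, i) = y'), |c b * (h (tgt b) - h (src b))|) +
      (∑ b ∈ Finset.univ.filter (fun b => tgt b = x),
        ∑ k ∈ Finset.univ.filter (fun k => blkY (b, k) = y'), |c b * (h (tgt b) - h (src b)) * Rm b k i|) ≤
      (Nd + Nd * Fintype.card Cp) * indK S' ρ θ (blk (x, i)) y' := by
  have hK0 : 0 ≤ indK S' ρ θ (blk (x, i)) y' := indK_nonneg hθ0 _ _
  have h1 := domT_of_size blk blkY src tgt c h Nd hθ0 hθ hNs hsupp hadj x i y'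
  have h2 : (∑ b ∈ Finset.univ.filter (fun b => tgt b = x),
        ∑ k ∈ Finset.univ.filter (fun k => blkY (b, k) = y'), |c b * (h (tgt b) - h (src b)) * Rm b k i|) ≤
      Nd * (Fintype.card Cp * indK S' ρ θ (blk (x, i)) y') := by
    calc (∑ b ∈ Finset.univ.filter (fun b => tgt b = x),
          ∑ k ∈ Finset.univ.filter (fun k => blkY (b, k) = y'), |c b * (h (tgt b) - h (src b)) * Rm b k i|)
        ≤ ((Finset.univ.filter (fun b => tgt b = x)).card : ℝ) *
            (Fintype.card Cp * indK S' ρ θ (blk (x, i)) y') := by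
          rw [← nsmul_eq_mul]
          refine Finset.sum_le_card_nsmul _ _ _ fun b hb => ?_
          simp only [Finset.mem_filter, Finset.mem_univ, true_and] at hb
          calc ∑ k ∈ Finset.univ.filter (fun k => blkY (b, k) = y'), |c b * (h (tgt b) - h (src b)) * Rm b k i|
              ≤ ((Finset.univ.filter (fun k => blkY (b, k) = y')).card : ℝ) * indK S' ρ θ (blk (x, i)) y' := by
                rw [← nsmul_eq_mul]
                refine Finset.sum_le_card_nsmul _ _ _ fun k hk => ?_
                simp only [Finset.mem_filter, Finset.mem_univ, true_and] at hk
                rw [abs_mul]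
                by_cases hd : h (tgt b) = h (src b)
                · rw [hd, sub_self, mul_zero, abs_zero, zero_mul]
                  exact hK0
                · obtain ⟨-, e2, -, -⟩ := indK_eq_of_dh_ne (θ := θ) blk blkY src tgt h hsupp hadj hd i k
                  rw [hb, hk] at e2
                  rw [e2]
                  calc |c b * (h (tgt b) - h (src b))| * |Rm b k i|
                      ≤ |c b * (h (tgt b) - h (src b))| * 1 :=
                        mul_le_mul_of_nonneg_left (hR1 b k i) (abs_nonneg _)
                    _ ≤ θ := by rw [mul_one]; exact hθ b
            _ ≤ Fintype.card Cp * indK S' ρ θ (blk (x, i)) y' :=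
                mul_le_mul_of_nonneg_right (by exact_mod_cast Finset.card_le_univ _) hK0
      _ ≤ Nd * (Fintype.card Cp * indK S' ρ θ (blk (x, i)) y') :=
          mul_le_mul_of_nonneg_right (by exact_mod_cast hNt x) (mul_nonneg (Nat.cast_nonneg _) hK0)
  calc _ ≤ Nd * indK S' ρ θ (blk (x, i)) y' + Nd * (Fintype.card Cp * indK S' ρ θ (blk (x, i)) y') :=
        add_le_add h1 h2
    _ = (Nd + Nd * Fintype.card Cp) * indK S' ρ θ (blk (x, i)) y' := by ring

omit [Fintype g.Site] [Fintype Bd] [Fintype Cp] [DecidableEq St] in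
/-- **Pointwise size ⇒ `hdh`** (entry 2): the single (∂h)-coefficient of `leibRem h` on the bond component v is
dominated by indK between the bond block and the block of the tail component. [cite: Balaban1985BackgroundPropagators, (3.88)–(3.89) p.409] -/
theorem dh_of_size {S' : Finset g.Site} {ρ θ : ℝ} (blk : St × Cp → g.Site) (blkY : Bd × Cp → g.Site)
    (src tgt : Bd → St) (c : Bd → ℝ) (h : St → ℝ) (hθ0 : 0 ≤ θ)
    (hθ : ∀ b, |c b * (h (tgt b) - h (src b))| ≤ θ)
    (hsupp : ∀ b, h (tgt b) ≠ h (src b) →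
      (∀ i, blk (src b, i) ∈ S' ∧ blk (tgt b, i) ∈ S') ∧ ∀ k, blkY (b, k) ∈ S')
    (hadj : ∀ b i k, g.dist (blk (src b, i)) (blkY (b, k)) ≤ ρ ∧ g.dist (blk (tgt b, i)) (blkY (b, k)) ≤ ρ ∧
      g.dist (blkY (b, k)) (blk (src b, i)) ≤ ρ ∧ g.dist (blkY (b, k)) (blk (tgt b, i)) ≤ ρ)
    (b : Bd) (k : Cp) :
    |c b * (h (tgt b) - h (src b))| ≤ indK S' ρ θ (blkY (b, k)) (blk (src b, k)) := by
  by_cases hd : h (tgt b) = h (src b)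
  · rw [hd, sub_self, mul_zero, abs_zero]
    exact indK_nonneg hθ0 _ _
  · obtain ⟨-, -, e3, -⟩ := indK_eq_of_dh_ne (θ := θ) blk blkY src tgt h hsupp hadj hd k k
    rw [e3]
    exact hθ b

omit [Fintype g.Site] [Fintype Bd] [DecidableEq St] in
/-- **Pointwise size ⇒ `hdhSt`** (entry 3): the tail indicator plus the R-transported head components of the
(∂h)-coefficient on the bond component v are dominated by (1 + #Cp)·indK. [cite: Balaban1985BackgroundPropagators, (3.88)–(3.89) p.409 + p.391] -/
theorem dhSt_of_size {S' : Finset g.Site} {ρ θ : ℝ} (blk : St × Cp → g.Site) (blkY : Bd × Cp → g.Site)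
    (src tgt : Bd → St) (c : Bd → ℝ) (Rm : Bd → Cp → Cp → ℝ) (h : St → ℝ) (hθ0 : 0 ≤ θ)
    (hθ : ∀ b, |c b * (h (tgt b) - h (src b))| ≤ θ) (hR1 : ∀ b k i, |Rm b k i| ≤ 1)
    (hsupp : ∀ b, h (tgt b) ≠ h (src b) →
      (∀ i, blk (src b, i) ∈ S' ∧ blk (tgt b, i) ∈ S') ∧ ∀ k, blkY (b, k) ∈ S')
    (hadj : ∀ b i k, g.dist (blk (src b, i)) (blkY (b, k)) ≤ ρ ∧ g.dist (blk (tgt b, i)) (blkY (b, k)) ≤ ρ ∧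
      g.dist (blkY (b, k)) (blk (src b, i)) ≤ ρ ∧ g.dist (blkY (b, k)) (blk (tgt b, i)) ≤ ρ)
    (b : Bd) (k : Cp) (y' : g.Site) :
    (if blk (src b, k) = y' then |c b * (h (tgt b) - h (src b))| else 0) +
        (∑ i ∈ Finset.univ.filter (fun i => blk (tgt b, i) = y'),
          |c b * (h (tgt b) - h (src b)) * Rm b k i|) ≤
      (1 + Fintype.card Cp) * indK S' ρ θ (blkY (b, k)) y' := by
  have hK0 : 0 ≤ indK S' ρ θ (blkY (b, k)) y' := indK_nonneg hθ0 _ _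
  by_cases hd : h (tgt b) = h (src b)
  · have h0 : c b * (h (tgt b) - h (src b)) = 0 := by rw [hd, sub_self, mul_zero]
    rw [h0, abs_zero]
    simp only [zero_mul, abs_zero, Finset.sum_const_zero, add_zero, ite_self]
    exact mul_nonneg (by positivity) hK0
  · have h1 : (if blk (src b, k) = y' then |c b * (h (tgt b) - h (src b))| else 0) ≤
        indK S' ρ θ (blkY (b, k)) y' := by
      by_cases hy : blk (src b, k) = y'
      · rw [if_pos hy]
        obtain ⟨-, -, e3, -⟩ := indK_eq_of_dh_ne (θ := θ) blk blkY src tgt h hsupp hadj hd k k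
        rw [hy] at e3
        rw [e3]
        exact hθ b
      · rw [if_neg hy]
        exact hK0
    have h2 : (∑ i ∈ Finset.univ.filter (fun i => blk (tgt b, i) = y'),
          |c b * (h (tgt b) - h (src b)) * Rm b k i|) ≤ Fintype.card Cp * indK S' ρ θ (blkY (b, k)) y' := by
      calc (∑ i ∈ Finset.univ.filter (fun i => blk (tgt b, i) = y'), |c b * (h (tgt b) - h (src b)) * Rm b k i|)
          ≤ ((Finset.univ.filter (fun i => blk (tgt b, i) = y')).card : ℝ) * indK S' ρ θ (blkY (b, k)) y' := by
            rw [← nsmul_eq_mul]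
            refine Finset.sum_le_card_nsmul _ _ _ fun i hi => ?_
            simp only [Finset.mem_filter, Finset.mem_univ, true_and] at hi
            obtain ⟨-, -, -, e4⟩ := indK_eq_of_dh_ne (θ := θ) blk blkY src tgt h hsupp hadj hd i k
            rw [hi] at e4
            rw [e4, abs_mul]
            calc |c b * (h (tgt b) - h (src b))| * |Rm b k i|
                ≤ |c b * (h (tgt b) - h (src b))| * 1 := mul_le_mul_of_nonneg_left (hR1 b k i) (abs_nonneg _)
              _ ≤ θ := by rw [mul_one]; exact hθ b
        _ ≤ Fintype.card Cp * indK S' ρ θ (blkY (b, k)) y' :=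
            mul_le_mul_of_nonneg_right (by exact_mod_cast Finset.card_le_univ _) hK0
    calc _ ≤ indK S' ρ θ (blkY (b, k)) y' + Fintype.card Cp * indK S' ρ θ (blkY (b, k)) y' := add_le_add h1 h2
      _ = (1 + Fintype.card Cp) * indK S' ρ θ (blkY (b, k)) y' := by ring

omit [Fintype g.Site] [DecidableEq g.Site] [Fintype Cp] in
/-- **Located support of Δh**: if no block of the point x lies in S′ then (Δh)(x) = `slap h x` = 0 (every bond of
the star of x has (∂h)(b) = 0 by `hsupp`). [folklore] -/
theorem slap_eq_zero_of_far {S' : Finset g.Site} (blk : St × Cp → g.Site) (blkY : Bd × Cp → g.Site)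
    (src tgt : Bd → St) (c : Bd → ℝ) (h : St → ℝ)
    (hsupp : ∀ b, h (tgt b) ≠ h (src b) →
      (∀ i, blk (src b, i) ∈ S' ∧ blk (tgt b, i) ∈ S') ∧ ∀ k, blkY (b, k) ∈ S')
    (x : St) (i : Cp) (hx : blk (x, i) ∉ S') : slap src tgt c h x = 0 := by
  rw [slap_apply]
  refine Finset.sum_eq_zero fun b _ => ?_
  have key : tgt b = x ∨ src b = x → h (tgt b) - h (src b) = 0 := fun hb => by
    by_contra hne
    have hs := (hsupp b (sub_ne_zero.mp hne)).1 i
    rcases hb with hb | hb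
    · exact hx (hb ▸ hs.2)
    · exact hx (hb ▸ hs.1)
  by_cases ht : tgt b = x
  · rw [key (Or.inl ht), mul_zero, mul_zero]
    simp
  · by_cases hs' : src b = x
    · rw [key (Or.inr hs'), mul_zero, mul_zero]
      simp
    · rw [if_neg ht, if_neg hs', sub_zero]

omit [Fintype g.Site] [Fintype Cp] in
/-- **Pointwise size ⇒ `hdiag`**: |(Δh)(x)| ≦ θ₂ everywhere and (Δh)(x) = 0 off S′ give the diagonal domination by
`diagK S′ θ₂`. [cite: Balaban1985BackgroundPropagators, (3.88)–(3.89) p.409] -/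
theorem diag_of_size {S' : Finset g.Site} {θ₂ : ℝ} (blk : St × Cp → g.Site) (blkY : Bd × Cp → g.Site)
    (src tgt : Bd → St) (c : Bd → ℝ) (h : St → ℝ) (hθ₂0 : 0 ≤ θ₂) (hθ₂ : ∀ x, |slap src tgt c h x| ≤ θ₂)
    (hsupp : ∀ b, h (tgt b) ≠ h (src b) →
      (∀ i, blk (src b, i) ∈ S' ∧ blk (tgt b, i) ∈ S') ∧ ∀ k, blkY (b, k) ∈ S')
    (x : St) (i : Cp) (y' : g.Site) :
    (if blk (x, i) = y' then |slap src tgt c h x| else 0) ≤ diagK S' θ₂ (blk (x, i)) y' := by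
  have hK0 : 0 ≤ diagK S' θ₂ (blk (x, i)) y' := diagK_nonneg hθ₂0 _ _
  by_cases hy : blk (x, i) = y'
  · rw [if_pos hy]
    by_cases hm : blk (x, i) ∈ S'
    · rw [show diagK S' θ₂ (blk (x, i)) y' = θ₂ from if_pos ⟨hm, hy⟩]
      exact hθ₂ x
    · rw [slap_eq_zero_of_far blk blkY src tgt c h hsupp x i hm, abs_zero]
      exact hK0
  · rw [if_neg hy]
    exact hK0

end Dominations

/-! ## §3  Theorem 3.7 ⇒ the four entries of (3.42) for G′ with the ∂h_□ / Δh_□ kernels DISCHARGED from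
pointwise sizes -/

section Entries

/-- **Theorem 3.7 ⇒ entry 4 of (3.42) for G′ (Δ_UG′, weight 1) with (3.88) DERIVED in the printed grouping and the
∂h_□ / Δh_□ kernels DISCHARGED from pointwise sizes** = `B9Thm37GlueSt.thm37_entry4_of_342_lattice_of_387_st` with
K_{S,□} := (N_d + N_d·#Cp)·indK S′_□ ρ θ_□ (`domSt_of_size`), K_{Δ,□} := diagK S′_□ θ_{2,□} (`diag_of_size`):
κ_S := (N_d + N_d·#Cp)·v₁, κ_Δ := v₂ with the volume products `hV₁` (θ_□ × Σ of L^{j″}η over the blocks of S′_□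
within ρ ≦ v₁), `hV₂` (θ_{2,□}(L^{j″}η)² ≦ v₂ on S′_□) — print: v₁ = O(M^{−1}), v₂ = O(M^{−2}), NOT asserted.  Q = Q′*aQ′
stays abstract (`hQ`, K_Q, κ_Q).  [cite: Balaban1985BackgroundPropagators, Thm 3.7 (3.87)–(3.90) pp.408–410 + (3.42) p.397 + (3.50) p.400; Balaban1984PropagatorsII, (2.36) p.229 + (2.40)–(2.44) p.230 + Prop 2.2 (2.67) p.234] -/
theorem thm37_entry4_of_342_lattice_of_387_sz [Fintype St] [DecidableEq St] [Fintype Cp] [DecidableEq Cp]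
    [Fintype Bd] (blk : St × Cp → g.Site) (blkY : Bd × Cp → g.Site) (src tgt : Bd → St) (c : Bd → ℝ)
    (Rm : Bd → Cp → Cp → ℝ) (Qf : Module.End ℝ (St × Cp → ℝ)) (d Nd : ℕ) (δ₀ α ρ B₀ v₁ v₂ κQ N N' : ℝ)
    {ι : Type} [Fintype ι] (S S' : ι → Finset g.Site) (hs : ι → St → ℝ) (θ θ₂ : ι → ℝ)
    (KQ : ι → g.Site → g.Site → ℝ) {G' : Module.End ℝ (St × Cp → ℝ)}
    (hRm : ∀ b i j, ∑ k, Rm b k i * Rm b k j = if i = j then 1 else 0)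
    (hB₀ : 0 ≤ B₀) (hδ₀ : 0 ≤ δ₀) (hρ : 0 ≤ ρ) (hv₁ : 0 ≤ v₁) (hv₂ : 0 ≤ v₂) (hκQ : 0 ≤ κQ) (hN : 0 ≤ N)
    (hN' : 0 ≤ N') (hαδ : 0 ≤ (1 - α) * δ₀)
    (htri : Triangle254 (toB6 g R H)) (hrefl : ∀ y : g.Site, g.dist y y = 0)
    (hdnn : ∀ y y' : g.Site, 0 ≤ g.dist y y') (hlen : ∀ y : g.Site, 0 ≤ g.len y)
    (h261 : Ineq261 d (toB6 g R H) δ₀ α) (h263 : Ineq263 d (toB6 g R H) δ₀ α)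
    (hsmall : N' * (B₀ * Real.exp (δ₀ * ρ) * ((Nd + Nd * Fintype.card Cp : ℝ) * v₁ + (v₂ + κQ))) *
      B6.c1 d δ₀ α < 1)
    (hh : ∀ i x, |hs i x| ≤ 1) (hS : ∀ i (p : St × Cp), hs i p.1 ≠ 0 → blk p ∈ S i)
    (hcnt : ∀ a : g.Site, (∑ i, if a ∈ S i then (1 : ℝ) else 0) ≤ N)
    (hcnt' : ∀ a : g.Site, (∑ i, if a ∈ S' i then (1 : ℝ) else 0) ≤ N')
    (hθ0 : ∀ i, 0 ≤ θ i) (hθ : ∀ i b, |c b * (hs i (tgt b) - hs i (src b))| ≤ θ i)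
    (hθ₂0 : ∀ i, 0 ≤ θ₂ i) (hθ₂ : ∀ i x, |slap src tgt c (hs i) x| ≤ θ₂ i)
    (hsupp : ∀ i b, hs i (tgt b) ≠ hs i (src b) →
      (∀ j, blk (src b, j) ∈ S' i ∧ blk (tgt b, j) ∈ S' i) ∧ ∀ k, blkY (b, k) ∈ S' i)
    (hNs : ∀ x : St, (Finset.univ.filter (fun b => src b = x)).card ≤ Nd)
    (hNt : ∀ x : St, (Finset.univ.filter (fun b => tgt b = x)).card ≤ Nd)
    (hadj : ∀ b i k, g.dist (blk (src b, i)) (blkY (b, k)) ≤ ρ ∧ g.dist (blk (tgt b, i)) (blkY (b, k)) ≤ ρ ∧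
      g.dist (blkY (b, k)) (blk (src b, i)) ≤ ρ ∧ g.dist (blkY (b, k)) (blk (tgt b, i)) ≤ ρ)
    (hV₁ : ∀ i (a : g.Site), a ∈ S' i → θ i * ∑ y ∈ (S' i).filter (fun y => g.dist a y ≤ ρ), g.len y ≤ v₁)
    (hV₂ : ∀ i (a : g.Site), a ∈ S' i → θ₂ i * g.len a ^ 2 ≤ v₂)
    (hKQ : ∀ i a b, 0 ≤ KQ i a b) (hlocQ : ∀ i a y'', KQ i a y'' ≠ 0 → g.dist a y'' ≤ ρ)
    (hrowQ : ∀ i (a : g.Site), ∑ y'' : g.Site, KQ i a y'' * g.len y'' ^ 2 ≤ if a ∈ S' i then κQ else 0)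
    (hsq : ∀ x : St, ∑ i, hs i x ^ 2 = 1)
    {Gsq : ι → Module.End ℝ (St × Cp → ℝ)}
    (h342_1 : ∀ i, HasMajorant (g := toB6 g R H) blk (Gsq i)
      (fun a b => B₀ * g.len a ^ 2 * Real.exp (-(δ₀ * g.dist a b))))
    (h342_2 : ∀ i, HasMajorantHom (g := toB6 g R H) blk blkY (covD src tgt c Rm ∘ₗ Gsq i)
      (fun a b => B₀ * g.len a * Real.exp (-(δ₀ * g.dist a b))))
    (h342_4 : ∀ i, HasMajorantHom (g := toB6 g R H) blk blk ((covDT src tgt c Rm ∘ₗ covD src tgt c Rm) ∘ₗ Gsq i)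
      (fun a b => B₀ * Real.exp (-(δ₀ * g.dist a b))))
    (hQ : ∀ i, HasMajorant (g := toB6 g R H) blk (mulOp (hs i ∘ Prod.fst) * Qf - Qf * mulOp (hs i ∘ Prod.fst)) (KQ i))
    (hloc : ∀ i, mulOp (hs i ∘ Prod.fst) * (covDT src tgt c Rm ∘ₗ covD src tgt c Rm + Qf) * Gsq i *
      mulOp (hs i ∘ Prod.fst) = mulOp (hs i ∘ Prod.fst) * mulOp (hs i ∘ Prod.fst))
    (hinv : G' * (covDT src tgt c Rm ∘ₗ covD src tgt c Rm + Qf) = 1) :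
    HasMajorantHom (g := toB6 g R H) blk blk ((covDT src tgt c Rm ∘ₗ covD src tgt c Rm) ∘ₗ G')
      (fun (a b : g.Site) => B₀ * (N + N' * Real.exp (δ₀ * ρ) * ((Nd + Nd * Fintype.card Cp : ℝ) * v₁ + v₂)) *
        B6.c1 d δ₀ α *
        (1 - N' * (B₀ * Real.exp (δ₀ * ρ) * ((Nd + Nd * Fintype.card Cp : ℝ) * v₁ + (v₂ + κQ))) *
          B6.c1 d δ₀ α)⁻¹ *
        Real.exp (-((1 - α) * δ₀ * g.dist a b))) := by
  have hR1 : ∀ b k i, |Rm b k i| ≤ 1 := abs_Rm_le_one Rm hRm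
  have hCS0 : (0 : ℝ) ≤ (Nd + Nd * Fintype.card Cp : ℝ) := by positivity
  have hKS : ∀ i (a b : g.Site), 0 ≤ (Nd + Nd * Fintype.card Cp : ℝ) * indK (S' i) ρ (θ i) a b :=
    fun i a b => mul_nonneg hCS0 (indK_nonneg (hθ0 i) a b)
  have hlocS : ∀ i (a y'' : g.Site), (Nd + Nd * Fintype.card Cp : ℝ) * indK (S' i) ρ (θ i) a y'' ≠ 0 →
      g.dist a y'' ≤ ρ := fun i a y'' hne => indK_loc (mul_ne_zero_iff.mp hne).2
  have hrowS : ∀ i (a : g.Site),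
      ∑ y'' : g.Site, (Nd + Nd * Fintype.card Cp : ℝ) * indK (S' i) ρ (θ i) a y'' * g.len y'' ≤
        if a ∈ S' i then (Nd + Nd * Fintype.card Cp : ℝ) * v₁ else 0 := fun i a => by
    have hrw : ∑ y'' : g.Site, (Nd + Nd * Fintype.card Cp : ℝ) * indK (S' i) ρ (θ i) a y'' * g.len y'' =
        (Nd + Nd * Fintype.card Cp : ℝ) * ∑ y'' : g.Site, indK (S' i) ρ (θ i) a y'' * g.len y'' := by
      rw [Finset.mul_sum]
      exact Finset.sum_congr rfl fun _ _ => by ring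
    rw [hrw, rowSum_indK]
    split_ifs with ha
    · exact mul_le_mul_of_nonneg_left (hV₁ i a ha) hCS0
    · rw [mul_zero]
  have hKD : ∀ i (a b : g.Site), 0 ≤ diagK (S' i) (θ₂ i) a b := fun i a b => diagK_nonneg (hθ₂0 i) a b
  have hlocD : ∀ i (a y'' : g.Site), diagK (S' i) (θ₂ i) a y'' ≠ 0 → g.dist a y'' ≤ ρ :=
    fun i a y'' hne => diagK_loc hrefl hρ hne
  have hrowD : ∀ i (a : g.Site), ∑ y'' : g.Site, diagK (S' i) (θ₂ i) a y'' * g.len y'' ^ 2 ≤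
      if a ∈ S' i then v₂ else 0 := fun i a => by
    rw [rowSum_diagK]
    split_ifs with ha
    · exact hV₂ i a ha
    · exact le_rfl
  have hdomSt' : ∀ i (p : St × Cp) (y' : g.Site),
      (∑ b ∈ Finset.univ.filter (fun b => src b = p.1 ∧ blkY (b, p.2) = y'),
          |c b * (hs i (tgt b) - hs i (src b))|) +
        (∑ b ∈ Finset.univ.filter (fun b => tgt b = p.1),
          ∑ k ∈ Finset.univ.filter (fun k => blkY (b, k) = y'),
            |c b * (hs i (tgt b) - hs i (src b)) * Rm b k p.2|) ≤
        (Nd + Nd * Fintype.card Cp : ℝ) * indK (S' i) ρ (θ i) (blk p) y' := fun i p y' =>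
    domSt_of_size blk blkY src tgt c Rm (hs i) Nd (hθ0 i) (hθ i) hR1 hNs hNt (hsupp i) hadj p.1 p.2 y'
  have hdiag' : ∀ i (p : St × Cp) (y' : g.Site),
      (if blk p = y' then |slap src tgt c (hs i) p.1| else 0) ≤ diagK (S' i) (θ₂ i) (blk p) y' := fun i p y' =>
    diag_of_size blk blkY src tgt c (hs i) (hθ₂0 i) (hθ₂ i) (hsupp i) p.1 p.2 y'
  exact thm37_entry4_of_342_lattice_of_387_st blk blkY src tgt c Rm Qf d δ₀ α ρ B₀
    ((Nd + Nd * Fintype.card Cp : ℝ) * v₁) v₂ κQ N N' S S' hs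
    (fun i a y => (Nd + Nd * Fintype.card Cp : ℝ) * indK (S' i) ρ (θ i) a y) (fun i => diagK (S' i) (θ₂ i)) KQ
    hRm hB₀ hδ₀ (mul_nonneg hCS0 hv₁) hv₂ hκQ hN hN' hαδ htri hrefl hdnn hlen h261 h263 hsmall hh hS hcnt hcnt'
    hKS hlocS hrowS hKD hlocD hrowD hKQ hlocQ hrowQ hdomSt' hdiag' hsq h342_1 h342_2 h342_4 hQ hloc hinv

/-- **Theorem 3.7 ⇒ entry 2 of (3.42) for G′ (∇_UG′, weight L^{j″}η) with (3.88) DERIVED in the printed grouping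
and the ∂h_□ / Δh_□ kernels DISCHARGED from pointwise sizes** = `B9Thm37GlueSt.thm37_entry2_of_342_lattice_of_387_st`
with K_S, K_Δ as in `thm37_entry4_of_342_lattice_of_387_sz` and the outer bond kernel K_{C′,□} := indK S′_□ ρ θ_□
(`dh_of_size`), whose row sums against (L^{j″}η)² are θ_□ × Σ(L^{j″}η)² over the blocks of S′_□ within ρ — bounded
by κ₄·L^{j}η of the row block through `hV₃` (print: κ₄ = O(M^{−1}), NOT asserted).
[cite: Balaban1985BackgroundPropagators, Thm 3.7 (3.87)–(3.90) pp.408–410 + (3.42) p.397 + (3.50) p.400; Balaban1984PropagatorsII, (2.36) p.229 + (2.40)–(2.44) p.230 + Prop 2.2 (2.67) p.234] -/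
theorem thm37_entry2_of_342_lattice_of_387_sz [Fintype St] [DecidableEq St] [Fintype Bd] [DecidableEq Bd]
    [Fintype Cp] [DecidableEq Cp]
    (src tgt : Bd → St) (c : Bd → ℝ) (Rm : Bd → Cp → Cp → ℝ) (Qf : Module.End ℝ (St × Cp → ℝ))
    (blk : St × Cp → g.Site) (blkY : Bd × Cp → g.Site) (d Nd : ℕ) (δ₀ α ρ B₀ v₁ v₂ κQ κ₄ N N' : ℝ) {ι : Type}
    [Fintype ι] (S S' : ι → Finset g.Site) (hs : ι → St → ℝ) (θ θ₂ : ι → ℝ) (KQ : ι → g.Site → g.Site → ℝ)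
    {G' : Module.End ℝ (St × Cp → ℝ)}
    (hRm : ∀ b i j, ∑ k, Rm b k i * Rm b k j = if i = j then 1 else 0)
    (hB₀ : 0 ≤ B₀) (hδ₀ : 0 ≤ δ₀) (hρ : 0 ≤ ρ) (hv₁ : 0 ≤ v₁) (hv₂ : 0 ≤ v₂) (hκQ : 0 ≤ κQ) (hκ₄ : 0 ≤ κ₄)
    (hN : 0 ≤ N) (hN' : 0 ≤ N') (hαδ : 0 ≤ (1 - α) * δ₀)
    (htri : Triangle254 (toB6 g R H)) (hrefl : ∀ y : g.Site, g.dist y y = 0)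
    (hdnn : ∀ y y' : g.Site, 0 ≤ g.dist y y') (hlen : ∀ y : g.Site, 0 ≤ g.len y)
    (h261 : Ineq261 d (toB6 g R H) δ₀ α) (h263 : Ineq263 d (toB6 g R H) δ₀ α)
    (hsmall : N' * (B₀ * Real.exp (δ₀ * ρ) * ((Nd + Nd * Fintype.card Cp : ℝ) * v₁ + (v₂ + κQ))) *
      B6.c1 d δ₀ α < 1)
    (hh : ∀ i x, |hs i x| ≤ 1) (hSY : ∀ i (v : Bd × Cp), hs i (tgt v.1) ≠ 0 → blkY v ∈ S i)
    (hcnt : ∀ a : g.Site, (∑ i, if a ∈ S i then (1 : ℝ) else 0) ≤ N)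
    (hcnt' : ∀ a : g.Site, (∑ i, if a ∈ S' i then (1 : ℝ) else 0) ≤ N')
    (hθ0 : ∀ i, 0 ≤ θ i) (hθ : ∀ i b, |c b * (hs i (tgt b) - hs i (src b))| ≤ θ i)
    (hθ₂0 : ∀ i, 0 ≤ θ₂ i) (hθ₂ : ∀ i x, |slap src tgt c (hs i) x| ≤ θ₂ i)
    (hsupp : ∀ i b, hs i (tgt b) ≠ hs i (src b) →
      (∀ j, blk (src b, j) ∈ S' i ∧ blk (tgt b, j) ∈ S' i) ∧ ∀ k, blkY (b, k) ∈ S' i)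
    (hNs : ∀ x : St, (Finset.univ.filter (fun b => src b = x)).card ≤ Nd)
    (hNt : ∀ x : St, (Finset.univ.filter (fun b => tgt b = x)).card ≤ Nd)
    (hadj : ∀ b i k, g.dist (blk (src b, i)) (blkY (b, k)) ≤ ρ ∧ g.dist (blk (tgt b, i)) (blkY (b, k)) ≤ ρ ∧
      g.dist (blkY (b, k)) (blk (src b, i)) ≤ ρ ∧ g.dist (blkY (b, k)) (blk (tgt b, i)) ≤ ρ)
    (hV₁ : ∀ i (a : g.Site), a ∈ S' i → θ i * ∑ y ∈ (S' i).filter (fun y => g.dist a y ≤ ρ), g.len y ≤ v₁)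
    (hV₂ : ∀ i (a : g.Site), a ∈ S' i → θ₂ i * g.len a ^ 2 ≤ v₂)
    (hV₃ : ∀ i (a : g.Site), a ∈ S' i →
      θ i * ∑ y ∈ (S' i).filter (fun y => g.dist a y ≤ ρ), g.len y ^ 2 ≤ κ₄ * g.len a)
    (hKQ : ∀ i a b, 0 ≤ KQ i a b) (hlocQ : ∀ i a y'', KQ i a y'' ≠ 0 → g.dist a y'' ≤ ρ)
    (hrowQ : ∀ i (a : g.Site), ∑ y'' : g.Site, KQ i a y'' * g.len y'' ^ 2 ≤ if a ∈ S' i then κQ else 0)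
    (hsq : ∀ x : St, ∑ i, hs i x ^ 2 = 1)
    {Gsq : ι → Module.End ℝ (St × Cp → ℝ)}
    (h342_1 : ∀ i, HasMajorant (g := toB6 g R H) blk (Gsq i)
      (fun a b => B₀ * g.len a ^ 2 * Real.exp (-(δ₀ * g.dist a b))))
    (h342_2 : ∀ i, HasMajorantHom (g := toB6 g R H) blk blkY (covD src tgt c Rm ∘ₗ Gsq i)
      (fun a b => B₀ * g.len a * Real.exp (-(δ₀ * g.dist a b))))
    (hQ : ∀ i, HasMajorant (g := toB6 g R H) blk (mulOp (hs i ∘ Prod.fst) * Qf - Qf * mulOp (hs i ∘ Prod.fst)) (KQ i))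
    (hloc : ∀ i, mulOp (hs i ∘ Prod.fst) * (covDT src tgt c Rm ∘ₗ covD src tgt c Rm + Qf) * Gsq i *
      mulOp (hs i ∘ Prod.fst) = mulOp (hs i ∘ Prod.fst) * mulOp (hs i ∘ Prod.fst))
    (hinv : G' * (covDT src tgt c Rm ∘ₗ covD src tgt c Rm + Qf) = 1) :
    HasMajorantHom (g := toB6 g R H) blk blkY (covD src tgt c Rm ∘ₗ G')
      (fun (a b : g.Site) => B₀ * (N + N' * Real.exp (δ₀ * ρ) * κ₄) * B6.c1 d δ₀ α *
        (1 - N' * (B₀ * Real.exp (δ₀ * ρ) * ((Nd + Nd * Fintype.card Cp : ℝ) * v₁ + (v₂ + κQ))) *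
          B6.c1 d δ₀ α)⁻¹ * g.len a *
        Real.exp (-((1 - α) * δ₀ * g.dist a b))) := by
  have hR1 : ∀ b k i, |Rm b k i| ≤ 1 := abs_Rm_le_one Rm hRm
  have hCS0 : (0 : ℝ) ≤ (Nd + Nd * Fintype.card Cp : ℝ) := by positivity
  have hKS : ∀ i (a b : g.Site), 0 ≤ (Nd + Nd * Fintype.card Cp : ℝ) * indK (S' i) ρ (θ i) a b :=
    fun i a b => mul_nonneg hCS0 (indK_nonneg (hθ0 i) a b)
  have hlocS : ∀ i (a y'' : g.Site), (Nd + Nd * Fintype.card Cp : ℝ) * indK (S' i) ρ (θ i) a y'' ≠ 0 →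
      g.dist a y'' ≤ ρ := fun i a y'' hne => indK_loc (mul_ne_zero_iff.mp hne).2
  have hrowS : ∀ i (a : g.Site),
      ∑ y'' : g.Site, (Nd + Nd * Fintype.card Cp : ℝ) * indK (S' i) ρ (θ i) a y'' * g.len y'' ≤
        if a ∈ S' i then (Nd + Nd * Fintype.card Cp : ℝ) * v₁ else 0 := fun i a => by
    have hrw : ∑ y'' : g.Site, (Nd + Nd * Fintype.card Cp : ℝ) * indK (S' i) ρ (θ i) a y'' * g.len y'' =
        (Nd + Nd * Fintype.card Cp : ℝ) * ∑ y'' : g.Site, indK (S' i) ρ (θ i) a y'' * g.len y'' := by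
      rw [Finset.mul_sum]
      exact Finset.sum_congr rfl fun _ _ => by ring
    rw [hrw, rowSum_indK]
    split_ifs with ha
    · exact mul_le_mul_of_nonneg_left (hV₁ i a ha) hCS0
    · rw [mul_zero]
  have hKD : ∀ i (a b : g.Site), 0 ≤ diagK (S' i) (θ₂ i) a b := fun i a b => diagK_nonneg (hθ₂0 i) a b
  have hlocD : ∀ i (a y'' : g.Site), diagK (S' i) (θ₂ i) a y'' ≠ 0 → g.dist a y'' ≤ ρ :=
    fun i a y'' hne => diagK_loc hrefl hρ hne
  have hrowD : ∀ i (a : g.Site), ∑ y'' : g.Site, diagK (S' i) (θ₂ i) a y'' * g.len y'' ^ 2 ≤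
      if a ∈ S' i then v₂ else 0 := fun i a => by
    rw [rowSum_diagK]
    split_ifs with ha
    · exact hV₂ i a ha
    · exact le_rfl
  have hdomSt' : ∀ i (p : St × Cp) (y' : g.Site),
      (∑ b ∈ Finset.univ.filter (fun b => src b = p.1 ∧ blkY (b, p.2) = y'),
          |c b * (hs i (tgt b) - hs i (src b))|) +
        (∑ b ∈ Finset.univ.filter (fun b => tgt b = p.1),
          ∑ k ∈ Finset.univ.filter (fun k => blkY (b, k) = y'),
            |c b * (hs i (tgt b) - hs i (src b)) * Rm b k p.2|) ≤
        (Nd + Nd * Fintype.card Cp : ℝ) * indK (S' i) ρ (θ i) (blk p) y' := fun i p y' =>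
    domSt_of_size blk blkY src tgt c Rm (hs i) Nd (hθ0 i) (hθ i) hR1 hNs hNt (hsupp i) hadj p.1 p.2 y'
  have hdiag' : ∀ i (p : St × Cp) (y' : g.Site),
      (if blk p = y' then |slap src tgt c (hs i) p.1| else 0) ≤ diagK (S' i) (θ₂ i) (blk p) y' := fun i p y' =>
    diag_of_size blk blkY src tgt c (hs i) (hθ₂0 i) (hθ₂ i) (hsupp i) p.1 p.2 y'
  have hKC' : ∀ i (a b : g.Site), 0 ≤ indK (S' i) ρ (θ i) a b := fun i a b => indK_nonneg (hθ0 i) a b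
  have hlocC' : ∀ i (a y'' : g.Site), indK (S' i) ρ (θ i) a y'' ≠ 0 → g.dist a y'' ≤ ρ :=
    fun i a y'' hne => indK_loc hne
  have hrowC' : ∀ i (a : g.Site), ∑ y'' : g.Site, indK (S' i) ρ (θ i) a y'' * g.len y'' ^ 2 ≤
      if a ∈ S' i then κ₄ * g.len a else 0 := fun i a => by
    rw [rowSum_indK]
    split_ifs with ha
    · exact hV₃ i a ha
    · exact le_rfl
  have hdh' : ∀ i (v : Bd × Cp), |c v.1 * (hs i (tgt v.1) - hs i (src v.1))| ≤
      indK (S' i) ρ (θ i) (blkY v) (blk (src v.1, v.2)) := fun i v =>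
    dh_of_size blk blkY src tgt c (hs i) (hθ0 i) (hθ i) (hsupp i) hadj v.1 v.2
  exact thm37_entry2_of_342_lattice_of_387_st src tgt c Rm Qf blk blkY d δ₀ α ρ B₀
    ((Nd + Nd * Fintype.card Cp : ℝ) * v₁) v₂ κQ κ₄ N N' S S' hs
    (fun i a y => (Nd + Nd * Fintype.card Cp : ℝ) * indK (S' i) ρ (θ i) a y) (fun i => diagK (S' i) (θ₂ i)) KQ
    (fun i => indK (S' i) ρ (θ i))
    hRm hB₀ hδ₀ (mul_nonneg hCS0 hv₁) hv₂ hκQ hκ₄ hN hN' hαδ htri hrefl hdnn hlen h261 h263 hsmall hh hSY hcnt hcnt'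
    hKS hlocS hrowS hKD hlocD hrowD hKQ hlocQ hrowQ hKC' hlocC' hrowC' hdh' hdomSt' hdiag' hsq h342_1 h342_2 hQ
    hloc hinv

/-- **Theorem 3.7 ⇒ entry 1 of (3.42) for G′ (weight (L^{j″}η)²) with (3.88) DERIVED in the printed grouping and the
∂h_□ / Δh_□ kernels DISCHARGED from pointwise sizes** = `B9Thm37GlueSt.thm37_entry1_of_342_lattice_of_387_st` with
K_S, K_Δ as in `thm37_entry4_of_342_lattice_of_387_sz`.
[cite: Balaban1985BackgroundPropagators, Thm 3.7 (3.87)–(3.90) pp.408–410 + (3.42) p.397 + (3.50) p.400; Balaban1984PropagatorsII, (2.36) p.229 + (2.40)–(2.44) p.230 + Prop 2.2 (2.67) p.234] -/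
theorem thm37_entry1_of_342_lattice_of_387_sz [Fintype St] [DecidableEq St] [Fintype Bd] [DecidableEq Bd]
    [Fintype Cp] [DecidableEq Cp]
    (src tgt : Bd → St) (c : Bd → ℝ) (Rm : Bd → Cp → Cp → ℝ) (Qf : Module.End ℝ (St × Cp → ℝ))
    (blk : St × Cp → g.Site) (blkY : Bd × Cp → g.Site) (d Nd : ℕ) (δ₀ α ρ B₀ v₁ v₂ κQ N N' : ℝ) {ι : Type}
    [Fintype ι] (S S' : ι → Finset g.Site) (hs : ι → St → ℝ) (θ θ₂ : ι → ℝ) (KQ : ι → g.Site → g.Site → ℝ)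
    {G' : Module.End ℝ (St × Cp → ℝ)}
    (hRm : ∀ b i j, ∑ k, Rm b k i * Rm b k j = if i = j then 1 else 0)
    (hB₀ : 0 ≤ B₀) (hδ₀ : 0 ≤ δ₀) (hρ : 0 ≤ ρ) (hv₁ : 0 ≤ v₁) (hv₂ : 0 ≤ v₂) (hκQ : 0 ≤ κQ) (hN : 0 ≤ N)
    (hN' : 0 ≤ N') (hαδ : 0 ≤ (1 - α) * δ₀)
    (htri : Triangle254 (toB6 g R H)) (hrefl : ∀ y : g.Site, g.dist y y = 0)
    (hdnn : ∀ y y' : g.Site, 0 ≤ g.dist y y') (hlen : ∀ y : g.Site, 0 ≤ g.len y)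
    (h261 : Ineq261 d (toB6 g R H) δ₀ α) (h263 : Ineq263 d (toB6 g R H) δ₀ α)
    (hsmall : N' * (B₀ * Real.exp (δ₀ * ρ) * ((Nd + Nd * Fintype.card Cp : ℝ) * v₁ + (v₂ + κQ))) *
      B6.c1 d δ₀ α < 1)
    (hh : ∀ i x, |hs i x| ≤ 1) (hS : ∀ i (p : St × Cp), hs i p.1 ≠ 0 → blk p ∈ S i)
    (hcnt : ∀ a : g.Site, (∑ i, if a ∈ S i then (1 : ℝ) else 0) ≤ N)
    (hcnt' : ∀ a : g.Site, (∑ i, if a ∈ S' i then (1 : ℝ) else 0) ≤ N')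
    (hθ0 : ∀ i, 0 ≤ θ i) (hθ : ∀ i b, |c b * (hs i (tgt b) - hs i (src b))| ≤ θ i)
    (hθ₂0 : ∀ i, 0 ≤ θ₂ i) (hθ₂ : ∀ i x, |slap src tgt c (hs i) x| ≤ θ₂ i)
    (hsupp : ∀ i b, hs i (tgt b) ≠ hs i (src b) →
      (∀ j, blk (src b, j) ∈ S' i ∧ blk (tgt b, j) ∈ S' i) ∧ ∀ k, blkY (b, k) ∈ S' i)
    (hNs : ∀ x : St, (Finset.univ.filter (fun b => src b = x)).card ≤ Nd)
    (hNt : ∀ x : St, (Finset.univ.filter (fun b => tgt b = x)).card ≤ Nd)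
    (hadj : ∀ b i k, g.dist (blk (src b, i)) (blkY (b, k)) ≤ ρ ∧ g.dist (blk (tgt b, i)) (blkY (b, k)) ≤ ρ ∧
      g.dist (blkY (b, k)) (blk (src b, i)) ≤ ρ ∧ g.dist (blkY (b, k)) (blk (tgt b, i)) ≤ ρ)
    (hV₁ : ∀ i (a : g.Site), a ∈ S' i → θ i * ∑ y ∈ (S' i).filter (fun y => g.dist a y ≤ ρ), g.len y ≤ v₁)
    (hV₂ : ∀ i (a : g.Site), a ∈ S' i → θ₂ i * g.len a ^ 2 ≤ v₂)
    (hKQ : ∀ i a b, 0 ≤ KQ i a b) (hlocQ : ∀ i a y'', KQ i a y'' ≠ 0 → g.dist a y'' ≤ ρ)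
    (hrowQ : ∀ i (a : g.Site), ∑ y'' : g.Site, KQ i a y'' * g.len y'' ^ 2 ≤ if a ∈ S' i then κQ else 0)
    (hsq : ∀ x : St, ∑ i, hs i x ^ 2 = 1)
    {Gsq : ι → Module.End ℝ (St × Cp → ℝ)}
    (h342_1 : ∀ i, HasMajorant (g := toB6 g R H) blk (Gsq i)
      (fun a b => B₀ * g.len a ^ 2 * Real.exp (-(δ₀ * g.dist a b))))
    (h342_2 : ∀ i, HasMajorantHom (g := toB6 g R H) blk blkY (covD src tgt c Rm ∘ₗ Gsq i)
      (fun a b => B₀ * g.len a * Real.exp (-(δ₀ * g.dist a b))))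
    (hQ : ∀ i, HasMajorant (g := toB6 g R H) blk (mulOp (hs i ∘ Prod.fst) * Qf - Qf * mulOp (hs i ∘ Prod.fst)) (KQ i))
    (hloc : ∀ i, mulOp (hs i ∘ Prod.fst) * (covDT src tgt c Rm ∘ₗ covD src tgt c Rm + Qf) * Gsq i *
      mulOp (hs i ∘ Prod.fst) = mulOp (hs i ∘ Prod.fst) * mulOp (hs i ∘ Prod.fst))
    (hinv : G' * (covDT src tgt c Rm ∘ₗ covD src tgt c Rm + Qf) = 1) :
    HasMajorant (g := toB6 g R H) blk G'
      (fun (a b : g.Site) => N * B₀ * B6.c1 d δ₀ α *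
        (1 - N' * (B₀ * Real.exp (δ₀ * ρ) * ((Nd + Nd * Fintype.card Cp : ℝ) * v₁ + (v₂ + κQ))) *
          B6.c1 d δ₀ α)⁻¹ * g.len a ^ 2 *
        Real.exp (-((1 - α) * δ₀ * g.dist a b))) := by
  have hR1 : ∀ b k i, |Rm b k i| ≤ 1 := abs_Rm_le_one Rm hRm
  have hCS0 : (0 : ℝ) ≤ (Nd + Nd * Fintype.card Cp : ℝ) := by positivity
  have hKS : ∀ i (a b : g.Site), 0 ≤ (Nd + Nd * Fintype.card Cp : ℝ) * indK (S' i) ρ (θ i) a b :=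
    fun i a b => mul_nonneg hCS0 (indK_nonneg (hθ0 i) a b)
  have hlocS : ∀ i (a y'' : g.Site), (Nd + Nd * Fintype.card Cp : ℝ) * indK (S' i) ρ (θ i) a y'' ≠ 0 →
      g.dist a y'' ≤ ρ := fun i a y'' hne => indK_loc (mul_ne_zero_iff.mp hne).2
  have hrowS : ∀ i (a : g.Site),
      ∑ y'' : g.Site, (Nd + Nd * Fintype.card Cp : ℝ) * indK (S' i) ρ (θ i) a y'' * g.len y'' ≤
        if a ∈ S' i then (Nd + Nd * Fintype.card Cp : ℝ) * v₁ else 0 := fun i a => by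
    have hrw : ∑ y'' : g.Site, (Nd + Nd * Fintype.card Cp : ℝ) * indK (S' i) ρ (θ i) a y'' * g.len y'' =
        (Nd + Nd * Fintype.card Cp : ℝ) * ∑ y'' : g.Site, indK (S' i) ρ (θ i) a y'' * g.len y'' := by
      rw [Finset.mul_sum]
      exact Finset.sum_congr rfl fun _ _ => by ring
    rw [hrw, rowSum_indK]
    split_ifs with ha
    · exact mul_le_mul_of_nonneg_left (hV₁ i a ha) hCS0
    · rw [mul_zero]
  have hKD : ∀ i (a b : g.Site), 0 ≤ diagK (S' i) (θ₂ i) a b := fun i a b => diagK_nonneg (hθ₂0 i) a b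
  have hlocD : ∀ i (a y'' : g.Site), diagK (S' i) (θ₂ i) a y'' ≠ 0 → g.dist a y'' ≤ ρ :=
    fun i a y'' hne => diagK_loc hrefl hρ hne
  have hrowD : ∀ i (a : g.Site), ∑ y'' : g.Site, diagK (S' i) (θ₂ i) a y'' * g.len y'' ^ 2 ≤
      if a ∈ S' i then v₂ else 0 := fun i a => by
    rw [rowSum_diagK]
    split_ifs with ha
    · exact hV₂ i a ha
    · exact le_rfl
  have hdomSt' : ∀ i (p : St × Cp) (y' : g.Site),
      (∑ b ∈ Finset.univ.filter (fun b => src b = p.1 ∧ blkY (b, p.2) = y'),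
          |c b * (hs i (tgt b) - hs i (src b))|) +
        (∑ b ∈ Finset.univ.filter (fun b => tgt b = p.1),
          ∑ k ∈ Finset.univ.filter (fun k => blkY (b, k) = y'),
            |c b * (hs i (tgt b) - hs i (src b)) * Rm b k p.2|) ≤
        (Nd + Nd * Fintype.card Cp : ℝ) * indK (S' i) ρ (θ i) (blk p) y' := fun i p y' =>
    domSt_of_size blk blkY src tgt c Rm (hs i) Nd (hθ0 i) (hθ i) hR1 hNs hNt (hsupp i) hadj p.1 p.2 y'
  have hdiag' : ∀ i (p : St × Cp) (y' : g.Site),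
      (if blk p = y' then |slap src tgt c (hs i) p.1| else 0) ≤ diagK (S' i) (θ₂ i) (blk p) y' := fun i p y' =>
    diag_of_size blk blkY src tgt c (hs i) (hθ₂0 i) (hθ₂ i) (hsupp i) p.1 p.2 y'
  exact thm37_entry1_of_342_lattice_of_387_st src tgt c Rm Qf blk blkY d δ₀ α ρ B₀
    ((Nd + Nd * Fintype.card Cp : ℝ) * v₁) v₂ κQ N N' S S' hs
    (fun i a y => (Nd + Nd * Fintype.card Cp : ℝ) * indK (S' i) ρ (θ i) a y) (fun i => diagK (S' i) (θ₂ i)) KQ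
    hRm hB₀ hδ₀ (mul_nonneg hCS0 hv₁) hv₂ hκQ hN hN' hαδ htri hrefl hdnn hlen h261 h263 hsmall hh hS hcnt hcnt'
    hKS hlocS hrowS hKD hlocD hrowD hKQ hlocQ hrowQ hdomSt' hdiag' hsq h342_1 h342_2 hQ hloc hinv

/-- **Theorem 3.7 ⇒ entry 3 of (3.42) for G′ (G′∇*_U, weight L^{j″}η) with (3.88) DERIVED in the printed grouping
and the ∂h_□ / Δh_□ kernels DISCHARGED from pointwise sizes** = `B9Thm37GlueSt.thm37_entry3_of_342_lattice_of_387_st`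
(v2) with K_{P,□} := (1 + #Cp)·indK S′_□ ρ θ_□ (`dhSt_of_size`), K_{Δ,□} := diagK S′_□ θ_{2,□}, K_{C′,□} := N_d·indK
S′_□ ρ θ_□ (`domT_of_size`); the COLUMN sums are θ_□ × (number of blocks of S′_□ within ρ of the column block) ×
L^{j″}η, bounded by w₁ through `hC₁` (print: O(M^{−1}), NOT asserted), and θ_{2,□}(L^{j″}η)² ≦ v₂ (`hV₂`); κ₁ :=
(1 + #Cp)·w₁, κ₄ := N_d·w₁, κ_Δ := v₂.
[cite: Balaban1985BackgroundPropagators, Thm 3.7 (3.87)–(3.90) pp.408–410 + (3.42) p.397 + (3.50) p.400 + p.391; Balaban1984PropagatorsII, (2.36) p.229 + (2.40)–(2.44) p.230 + Prop 2.2 (2.67) p.234] -/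
theorem thm37_entry3_of_342_lattice_of_387_sz [Fintype St] [DecidableEq St] [Fintype Cp] [DecidableEq Cp]
    [Fintype Bd] [DecidableEq Bd] (blk : St × Cp → g.Site) (blkY : Bd × Cp → g.Site) (src tgt : Bd → St)
    (c : Bd → ℝ) (Rm : Bd → Cp → Cp → ℝ) (Qf : Module.End ℝ (St × Cp → ℝ)) (d Nd : ℕ)
    (δ₀ α ρ B₀ w₁ v₂ κQ Cℓ N N' : ℝ) {ι : Type} [Fintype ι]
    (S S' : ι → Finset g.Site) (hs : ι → St → ℝ) (θ θ₂ : ι → ℝ) (KQ : ι → g.Site → g.Site → ℝ)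
    {G' : Module.End ℝ (St × Cp → ℝ)}
    (hRm : ∀ b i j, ∑ k, Rm b k i * Rm b k j = if i = j then 1 else 0)
    (hB₀ : 0 ≤ B₀) (hδ₀ : 0 ≤ δ₀) (hρ : 0 ≤ ρ) (hw₁ : 0 ≤ w₁) (hv₂ : 0 ≤ v₂) (hκQ : 0 ≤ κQ) (hCℓ : 0 ≤ Cℓ)
    (hN : 0 ≤ N) (hN' : 0 ≤ N') (hαδ : 0 ≤ α * δ₀) (hαδ2 : 0 ≤ (1 - 2 * α) * δ₀)
    (htri : Triangle254 (toB6 g R H)) (hrefl : ∀ y : g.Site, g.dist y y = 0)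
    (hsym : ∀ y y' : g.Site, g.dist y y' = g.dist y' y) (hdnn : ∀ y y' : g.Site, 0 ≤ g.dist y y')
    (hlenpos : ∀ y : g.Site, 0 < g.len y)
    (h261 : Ineq261 d (toB6 g R H) δ₀ α) (h263 : Ineq263 d (toB6 g R H) δ₀ α)
    (hsmall : N' * (B₀ * Real.exp (δ₀ * ρ) * ((1 + Fintype.card Cp : ℝ) * w₁ + Cℓ * (v₂ + κQ))) *
      B6.c1 d δ₀ α < 1)
    (hh : ∀ i x, |hs i x| ≤ 1) (hS : ∀ i (p : St × Cp), hs i p.1 ≠ 0 → blk p ∈ S i)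
    (hcnt : ∀ a : g.Site, (∑ i, if a ∈ S i then (1 : ℝ) else 0) ≤ N)
    (hcnt' : ∀ b : g.Site, (∑ i, if b ∈ S' i then (1 : ℝ) else 0) ≤ N')
    (hcomp : ∀ i (a b : g.Site), a ∈ S i → b ∈ S' i → g.len a ≤ Cℓ * g.len b)
    (hθ0 : ∀ i, 0 ≤ θ i) (hθ : ∀ i b, |c b * (hs i (tgt b) - hs i (src b))| ≤ θ i)
    (hθ₂0 : ∀ i, 0 ≤ θ₂ i) (hθ₂ : ∀ i x, |slap src tgt c (hs i) x| ≤ θ₂ i)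
    (hsupp : ∀ i b, hs i (tgt b) ≠ hs i (src b) →
      (∀ j, blk (src b, j) ∈ S' i ∧ blk (tgt b, j) ∈ S' i) ∧ ∀ k, blkY (b, k) ∈ S' i)
    (hNs : ∀ x : St, (Finset.univ.filter (fun b => src b = x)).card ≤ Nd)
    (hadj : ∀ b i k, g.dist (blk (src b, i)) (blkY (b, k)) ≤ ρ ∧ g.dist (blk (tgt b, i)) (blkY (b, k)) ≤ ρ ∧
      g.dist (blkY (b, k)) (blk (src b, i)) ≤ ρ ∧ g.dist (blkY (b, k)) (blk (tgt b, i)) ≤ ρ)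
    (hC₁ : ∀ i (b : g.Site), b ∈ S' i →
      θ i * ((S' i).filter (fun y => g.dist y b ≤ ρ)).card * g.len b ≤ w₁)
    (hV₂ : ∀ i (a : g.Site), a ∈ S' i → θ₂ i * g.len a ^ 2 ≤ v₂)
    (hKQ : ∀ i a b, 0 ≤ KQ i a b) (hlocQ : ∀ i y'' b, KQ i y'' b ≠ 0 → g.dist y'' b ≤ ρ)
    (hcolQ : ∀ i (b : g.Site), (∑ y'' : g.Site, KQ i y'' b) * g.len b ^ 2 ≤ if b ∈ S' i then κQ else 0)
    (hsq : ∀ x : St, ∑ i, hs i x ^ 2 = 1)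
    {Gsq : ι → Module.End ℝ (St × Cp → ℝ)}
    (h342_1 : ∀ i, HasMajorant (g := toB6 g R H) blk (Gsq i)
      (fun a b => B₀ * g.len a ^ 2 * Real.exp (-(δ₀ * g.dist a b))))
    (h342_3 : ∀ i, HasMajorantHom (g := toB6 g R H) blkY blk (Gsq i ∘ₗ covDT src tgt c Rm)
      (fun a b => B₀ * g.len a * Real.exp (-(δ₀ * g.dist a b))))
    (hQ : ∀ i, HasMajorant (g := toB6 g R H) blk (mulOp (hs i ∘ Prod.fst) * Qf - Qf * mulOp (hs i ∘ Prod.fst)) (KQ i))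
    (hQt : IsTransposePair Qf Qf) (hG : ∀ i, IsTransposePair (Gsq i) (Gsq i))
    (hloc : ∀ i, mulOp (hs i ∘ Prod.fst) * (covDT src tgt c Rm ∘ₗ covD src tgt c Rm + Qf) * Gsq i *
      mulOp (hs i ∘ Prod.fst) = mulOp (hs i ∘ Prod.fst) * mulOp (hs i ∘ Prod.fst))
    (hinv : G' * (covDT src tgt c Rm ∘ₗ covD src tgt c Rm + Qf) = 1) :
    HasMajorantHom (g := toB6 g R H) blkY blk (G' ∘ₗ covDT src tgt c Rm)
      (fun (a b : g.Site) => B₀ * (N + N' * Real.exp (δ₀ * ρ) * Cℓ * (Nd * w₁)) * B6.c1 d δ₀ α *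
        (1 - N' * (B₀ * Real.exp (δ₀ * ρ) * ((1 + Fintype.card Cp : ℝ) * w₁ + Cℓ * (v₂ + κQ))) *
          B6.c1 d δ₀ α)⁻¹ * g.len a *
        Real.exp (-((1 - 2 * α) * δ₀ * g.dist a b))) := by
  have hR1 : ∀ b k i, |Rm b k i| ≤ 1 := abs_Rm_le_one Rm hRm
  have hC0 : (0 : ℝ) ≤ (1 + Fintype.card Cp : ℝ) := by positivity
  have hKP : ∀ i (a b : g.Site), 0 ≤ (1 + Fintype.card Cp : ℝ) * indK (S' i) ρ (θ i) a b :=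
    fun i a b => mul_nonneg hC0 (indK_nonneg (hθ0 i) a b)
  have hlocP : ∀ i (y'' b : g.Site), (1 + Fintype.card Cp : ℝ) * indK (S' i) ρ (θ i) y'' b ≠ 0 →
      g.dist y'' b ≤ ρ := fun i y'' b hne => indK_loc (mul_ne_zero_iff.mp hne).2
  have hcolP : ∀ i (b : g.Site), (∑ y'' : g.Site, (1 + Fintype.card Cp : ℝ) * indK (S' i) ρ (θ i) y'' b) *
      g.len b ≤ if b ∈ S' i then (1 + Fintype.card Cp : ℝ) * w₁ else 0 := fun i b => by
    rw [← Finset.mul_sum, colSum_indK]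
    split_ifs with hb
    · calc (1 + Fintype.card Cp : ℝ) * (θ i * (((S' i).filter (fun y => g.dist y b ≤ ρ)).card : ℝ)) * g.len b
          = (1 + Fintype.card Cp : ℝ) * (θ i * (((S' i).filter (fun y => g.dist y b ≤ ρ)).card : ℝ) * g.len b) := by
            ring
        _ ≤ (1 + Fintype.card Cp : ℝ) * w₁ := mul_le_mul_of_nonneg_left (hC₁ i b hb) hC0
    · rw [mul_zero, zero_mul]
  have hKD : ∀ i (a b : g.Site), 0 ≤ diagK (S' i) (θ₂ i) a b := fun i a b => diagK_nonneg (hθ₂0 i) a b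
  have hlocD : ∀ i (y'' b : g.Site), diagK (S' i) (θ₂ i) y'' b ≠ 0 → g.dist y'' b ≤ ρ :=
    fun i y'' b hne => diagK_loc hrefl hρ hne
  have hcolD : ∀ i (b : g.Site), (∑ y'' : g.Site, diagK (S' i) (θ₂ i) y'' b) * g.len b ^ 2 ≤
      if b ∈ S' i then v₂ else 0 := fun i b => by
    rw [colSum_diagK]
    split_ifs with hb
    · exact hV₂ i b hb
    · rw [zero_mul]
  have hN0 : (0 : ℝ) ≤ (Nd : ℝ) := Nat.cast_nonneg _
  have hKC' : ∀ i (a b : g.Site), 0 ≤ (Nd : ℝ) * indK (S' i) ρ (θ i) a b :=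
    fun i a b => mul_nonneg hN0 (indK_nonneg (hθ0 i) a b)
  have hlocC' : ∀ i (y'' b : g.Site), (Nd : ℝ) * indK (S' i) ρ (θ i) y'' b ≠ 0 → g.dist y'' b ≤ ρ :=
    fun i y'' b hne => indK_loc (mul_ne_zero_iff.mp hne).2
  have hcolC' : ∀ i (b : g.Site), (∑ y'' : g.Site, (Nd : ℝ) * indK (S' i) ρ (θ i) y'' b) * g.len b ≤
      if b ∈ S' i then (Nd : ℝ) * w₁ else 0 := fun i b => by
    rw [← Finset.mul_sum, colSum_indK]
    split_ifs with hb
    · calc (Nd : ℝ) * (θ i * (((S' i).filter (fun y => g.dist y b ≤ ρ)).card : ℝ)) * g.len b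
          = (Nd : ℝ) * (θ i * (((S' i).filter (fun y => g.dist y b ≤ ρ)).card : ℝ) * g.len b) := by ring
        _ ≤ (Nd : ℝ) * w₁ := mul_le_mul_of_nonneg_left (hC₁ i b hb) hN0
    · rw [mul_zero, zero_mul]
  have hdomT' : ∀ i (p : St × Cp) (y' : g.Site),
      ∑ b ∈ Finset.univ.filter (fun b => src b = p.1 ∧ blkY (b, p.2) = y'), |c b * (hs i (tgt b) - hs i (src b))| ≤
        (Nd : ℝ) * indK (S' i) ρ (θ i) (blk p) y' := fun i p y' =>
    domT_of_size blk blkY src tgt c (hs i) Nd (hθ0 i) (hθ i) hNs (hsupp i) hadj p.1 p.2 y'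
  have hdhSt' : ∀ i (v : Bd × Cp) (y' : g.Site),
      (if blk (src v.1, v.2) = y' then |c v.1 * (hs i (tgt v.1) - hs i (src v.1))| else 0) +
        (∑ k ∈ Finset.univ.filter (fun k => blk (tgt v.1, k) = y'),
          |c v.1 * (hs i (tgt v.1) - hs i (src v.1)) * Rm v.1 v.2 k|) ≤
        (1 + Fintype.card Cp : ℝ) * indK (S' i) ρ (θ i) (blkY v) y' := fun i v y' =>
    dhSt_of_size blk blkY src tgt c Rm (hs i) (hθ0 i) (hθ i) hR1 (hsupp i) hadj v.1 v.2 y'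
  have hdiag' : ∀ i (p : St × Cp) (y' : g.Site),
      (if blk p = y' then |slap src tgt c (hs i) p.1| else 0) ≤ diagK (S' i) (θ₂ i) (blk p) y' := fun i p y' =>
    diag_of_size blk blkY src tgt c (hs i) (hθ₂0 i) (hθ₂ i) (hsupp i) p.1 p.2 y'
  exact thm37_entry3_of_342_lattice_of_387_st blk blkY src tgt c Rm Qf d δ₀ α ρ B₀
    ((1 + Fintype.card Cp : ℝ) * w₁) v₂ κQ ((Nd : ℝ) * w₁) Cℓ N N' S S' hs
    (fun i y b => (1 + Fintype.card Cp : ℝ) * indK (S' i) ρ (θ i) y b) (fun i => diagK (S' i) (θ₂ i)) KQ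
    (fun i y b => (Nd : ℝ) * indK (S' i) ρ (θ i) y b)
    hRm hB₀ hδ₀ (mul_nonneg hC0 hw₁) hv₂ hκQ (mul_nonneg hN0 hw₁) hCℓ hN hN' hαδ hαδ2 htri hrefl hsym hdnn hlenpos
    h261 h263 hsmall hh hS hcnt hcnt' hcomp hKP hlocP hcolP hKD hlocD hcolD hKQ hlocQ hcolQ hKC' hlocC' hcolC' hdomT'
    hdhSt' hdiag' hsq h342_1 h342_3 hQ hQt hG hloc hinv

end Entries

/-! ## §4  The volume products v₁, κ₄, w₁ from primitive print-shaped bounds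

Print's shape: |∂h_□| ≦ O(1)(ML^jη)^{−1} ((1.118)/(2.36) of [4]: h_□ varies on the scale ML^jη) — here the
dimensionless product «θ_□ × (length of a block of S′_□) ≦ t» (`ht`; t = O(M^{−1}) up to the scale-boundary factor
L, NOT asserted); at most N_ρ blocks of S′_□ within ρ of a given block (`hcnt`, `hcnt′`; geometry of 𝒟, NOT
asserted); comparability of block lengths inside S′_□ within ρ (`hcomp`, constant C_ℓ ≦ L for neighbouring scales, NOT
asserted).  Then v₁ := N_ρC_ℓt, κ₄ := N_ρC_ℓ²t, w₁ := N_ρt inhabit `hV₁`, `hV₃`, `hC₁` of §3 (hV₂ — θ_{2,□}(L^{j″}η)²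
≦ v₂ — is already primitive: print's |Δh_□| ≦ O(1)(ML^jη)^{−2}). -/

section Volumes

omit [Fintype g.Site] [DecidableEq g.Site] in
/-- **v₁ from primitive bounds**: θ_□ Σ_{y ∈ S′_□, d(a,y) ≦ ρ} L^{j_y}η ≦ N_ρ·C_ℓ·t for a ∈ S′_□ (the shape of `hV₁`).
[cite: Balaban1984PropagatorsII, (2.36) p.229; Balaban1985BackgroundPropagators, (3.89) p.409] -/
theorem vol₁_of_prim {ι : Type} (S' : ι → Finset g.Site) (θ : ι → ℝ) (ρ t Cℓ : ℝ) (Nρ : ℕ)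
    (hlen : ∀ y : g.Site, 0 ≤ g.len y) (hθ0 : ∀ i, 0 ≤ θ i) (hCℓ : 0 ≤ Cℓ)
    (ht : ∀ i (a : g.Site), a ∈ S' i → θ i * g.len a ≤ t)
    (hcnt : ∀ i (a : g.Site), a ∈ S' i → ((S' i).filter (fun y => g.dist a y ≤ ρ)).card ≤ Nρ)
    (hcomp : ∀ i (a y : g.Site), a ∈ S' i → y ∈ S' i → g.dist a y ≤ ρ → g.len y ≤ Cℓ * g.len a) :
    ∀ i (a : g.Site), a ∈ S' i → θ i * ∑ y ∈ (S' i).filter (fun y => g.dist a y ≤ ρ), g.len y ≤ Nρ * Cℓ * t := by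
  intro i a ha
  have hsum : ∑ y ∈ (S' i).filter (fun y => g.dist a y ≤ ρ), g.len y ≤ (Nρ : ℝ) * (Cℓ * g.len a) := by
    calc ∑ y ∈ (S' i).filter (fun y => g.dist a y ≤ ρ), g.len y
        ≤ ∑ y ∈ (S' i).filter (fun y => g.dist a y ≤ ρ), Cℓ * g.len a := by
          refine Finset.sum_le_sum fun y hy => ?_
          rw [Finset.mem_filter] at hy
          exact hcomp i a y ha hy.1 hy.2
      _ = ((S' i).filter (fun y => g.dist a y ≤ ρ)).card * (Cℓ * g.len a) := by
          rw [Finset.sum_const, nsmul_eq_mul]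
      _ ≤ (Nρ : ℝ) * (Cℓ * g.len a) :=
          mul_le_mul_of_nonneg_right (by exact_mod_cast hcnt i a ha) (mul_nonneg hCℓ (hlen a))
  calc θ i * ∑ y ∈ (S' i).filter (fun y => g.dist a y ≤ ρ), g.len y ≤ θ i * ((Nρ : ℝ) * (Cℓ * g.len a)) :=
        mul_le_mul_of_nonneg_left hsum (hθ0 i)
    _ = (Nρ : ℝ) * Cℓ * (θ i * g.len a) := by ring
    _ ≤ (Nρ : ℝ) * Cℓ * t := mul_le_mul_of_nonneg_left (ht i a ha) (mul_nonneg (Nat.cast_nonneg Nρ) hCℓ)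

omit [Fintype g.Site] [DecidableEq g.Site] in
/-- **κ₄ from primitive bounds**: θ_□ Σ_{y ∈ S′_□, d(a,y) ≦ ρ} (L^{j_y}η)² ≦ N_ρ·C_ℓ²·t·L^{j_a}η for a ∈ S′_□ (the shape of
`hV₃`). [cite: Balaban1984PropagatorsII, (2.36) p.229; Balaban1985BackgroundPropagators, (3.89) p.409] -/
theorem vol₃_of_prim {ι : Type} (S' : ι → Finset g.Site) (θ : ι → ℝ) (ρ t Cℓ : ℝ) (Nρ : ℕ)
    (hlen : ∀ y : g.Site, 0 ≤ g.len y) (hθ0 : ∀ i, 0 ≤ θ i)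
    (ht : ∀ i (a : g.Site), a ∈ S' i → θ i * g.len a ≤ t)
    (hcnt : ∀ i (a : g.Site), a ∈ S' i → ((S' i).filter (fun y => g.dist a y ≤ ρ)).card ≤ Nρ)
    (hcomp : ∀ i (a y : g.Site), a ∈ S' i → y ∈ S' i → g.dist a y ≤ ρ → g.len y ≤ Cℓ * g.len a) :
    ∀ i (a : g.Site), a ∈ S' i →
      θ i * ∑ y ∈ (S' i).filter (fun y => g.dist a y ≤ ρ), g.len y ^ 2 ≤ Nρ * Cℓ ^ 2 * t * g.len a := by
  intro i a ha
  have hsum : ∑ y ∈ (S' i).filter (fun y => g.dist a y ≤ ρ), g.len y ^ 2 ≤ (Nρ : ℝ) * (Cℓ * g.len a) ^ 2 := by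
    calc ∑ y ∈ (S' i).filter (fun y => g.dist a y ≤ ρ), g.len y ^ 2
        ≤ ∑ y ∈ (S' i).filter (fun y => g.dist a y ≤ ρ), (Cℓ * g.len a) ^ 2 := by
          refine Finset.sum_le_sum fun y hy => ?_
          rw [Finset.mem_filter] at hy
          exact pow_le_pow_left₀ (hlen y) (hcomp i a y ha hy.1 hy.2) 2
      _ = ((S' i).filter (fun y => g.dist a y ≤ ρ)).card * (Cℓ * g.len a) ^ 2 := by
          rw [Finset.sum_const, nsmul_eq_mul]
      _ ≤ (Nρ : ℝ) * (Cℓ * g.len a) ^ 2 :=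
          mul_le_mul_of_nonneg_right (by exact_mod_cast hcnt i a ha) (sq_nonneg _)
  calc θ i * ∑ y ∈ (S' i).filter (fun y => g.dist a y ≤ ρ), g.len y ^ 2 ≤ θ i * ((Nρ : ℝ) * (Cℓ * g.len a) ^ 2) :=
        mul_le_mul_of_nonneg_left hsum (hθ0 i)
    _ = (Nρ : ℝ) * Cℓ ^ 2 * (θ i * g.len a) * g.len a := by ring
    _ ≤ (Nρ : ℝ) * Cℓ ^ 2 * t * g.len a :=
        mul_le_mul_of_nonneg_right
          (mul_le_mul_of_nonneg_left (ht i a ha) (mul_nonneg (Nat.cast_nonneg Nρ) (sq_nonneg Cℓ))) (hlen a)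

omit [Fintype g.Site] [DecidableEq g.Site] in
/-- **w₁ from primitive bounds**: θ_□ · #{y ∈ S′_□ : d(y,b) ≦ ρ} · L^{j_b}η ≦ N_ρ·t for b ∈ S′_□ (the shape of `hC₁`;
column count `hcnt′`). [cite: Balaban1984PropagatorsII, (2.36) p.229; Balaban1985BackgroundPropagators, (3.89) p.409] -/
theorem col₁_of_prim {ι : Type} (S' : ι → Finset g.Site) (θ : ι → ℝ) (ρ t : ℝ) (Nρ : ℕ)
    (hlen : ∀ y : g.Site, 0 ≤ g.len y) (hθ0 : ∀ i, 0 ≤ θ i)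
    (ht : ∀ i (b : g.Site), b ∈ S' i → θ i * g.len b ≤ t)
    (hcnt' : ∀ i (b : g.Site), b ∈ S' i → ((S' i).filter (fun y => g.dist y b ≤ ρ)).card ≤ Nρ) :
    ∀ i (b : g.Site), b ∈ S' i → θ i * ((S' i).filter (fun y => g.dist y b ≤ ρ)).card * g.len b ≤ Nρ * t := by
  intro i b hb
  have hc : (((S' i).filter (fun y => g.dist y b ≤ ρ)).card : ℝ) ≤ Nρ := by exact_mod_cast hcnt' i b hb
  calc θ i * ((S' i).filter (fun y => g.dist y b ≤ ρ)).card * g.len b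
      = ((S' i).filter (fun y => g.dist y b ≤ ρ)).card * (θ i * g.len b) := by ring
    _ ≤ (Nρ : ℝ) * (θ i * g.len b) := mul_le_mul_of_nonneg_right hc (mul_nonneg (hθ0 i) (hlen b))
    _ ≤ (Nρ : ℝ) * t := mul_le_mul_of_nonneg_left (ht i b hb) (Nat.cast_nonneg Nρ)

end Volumes

/-! ## §5  The transposition hypothesis `hGt`: inverses and Dirichlet sandwiches of symmetric operators

Entry 3 of the lineage (`B9Thm37GlueSt.thm37_entry3_of_342_lattice_of_387_st`, hence `…_sz` above) consumes
`hGt : IsTransposePair (G i) (G i)` — symmetry of print's G′_□.  B9 p. 409 [PDF 21] (verbatim, render p021-x2):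
*"the sequence {Ω_n(□)} satisfies the assumptions of Corollary 3.6. The operators constructed for this sequence,
which we denote by G′_□(U), C_□(U) = (Q′(U)G′_□²(U)Q′*(U))^{−1}, G_□(U), satisfy all the inequalities of Theorems
3.1–3.3 correspondingly."*; p. 394 [PDF 6] (verbatim, render p006-x2): *"For such Ω₀ we consider the operator Δ′_a
with Dirichlet boundary conditions on ∂Ω₀, i.e. the operator Δ′_a↾_{Ω₀} = Ω₀Δ′_aΩ₀. In the last expression Ω₀
denotes a characteristic function of Ω₀, Its inverse is denoted by G′, or G′(U)."* ([4] p. 229 (2.37): *"where G′(□)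
is an inverse of Δ′_a with some boundary conditions on the boundary of □, e.g. with Neumann boundary conditions as
in [3]."*).  In the cell's scalar model this is folklore linear algebra, recorded so that `hGt` is DISCHARGED from
the symmetry of Δ′_a (its two summands: `isTransposePair_covLap` for Δ^η_U and `B9Thm37GlueQ.conjOp_symm` for
Q′*aQ′ = Q′ᵀDQ′): the characteristic-function sandwich M_χTM_χ + M_{χ′} (χ = Ω₀ = 1_{Ω₀(□̃)}, χ′ = 1 − χ keeps it
invertible on all of X → ℝ — the model of Ω₀Δ′_aΩ₀) of a symmetric T is symmetric, and a (right) inverse of a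
symmetric operator is symmetric.  Nothing of print is asserted (in particular not the invertibility). -/

section Transpose

omit [Fintype g.Site] [DecidableEq g.Site]

variable {X Y : Type} [Fintype X] [Fintype Y]

/-- (A⁻¹)ᵗ = (Aᵗ)⁻¹: right inverses of a transpose pair form a transpose pair. [folklore] -/
theorem isTransposePair_of_rightInverse {A : (X → ℝ) →ₗ[ℝ] (Y → ℝ)} {B : (Y → ℝ) →ₗ[ℝ] (X → ℝ)}
    {S : (Y → ℝ) →ₗ[ℝ] (X → ℝ)} {S' : (X → ℝ) →ₗ[ℝ] (Y → ℝ)} (h : IsTransposePair A B)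
    (hS : A ∘ₗ S = LinearMap.id) (hS' : B ∘ₗ S' = LinearMap.id) : IsTransposePair S S' := by
  intro w z
  have hz : B (S' z) = z := by rw [← LinearMap.comp_apply, hS', LinearMap.id_apply]
  have hw : A (S w) = w := by rw [← LinearMap.comp_apply, hS, LinearMap.id_apply]
  calc ∑ x, S w x * z x = ∑ x, S w x * B (S' z) x := by rw [hz]
    _ = ∑ y, A (S w) y * S' z y := (h (S w) (S' z)).symm
    _ = ∑ y, w y * S' z y := by rw [hw]

omit [Fintype Y] in
/-- **The inverse of a symmetric operator is symmetric** (more generally (T⁻¹)ᵗ = (Tᵗ)⁻¹ for right inverses in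
`Module.End`): the shape of the hypothesis `hGt` of the entry-3 theorems for G′_□ := (Δ′_□)^{−1}. [folklore] -/
theorem isTransposePair_inv {T T' S S' : Module.End ℝ (X → ℝ)} (h : IsTransposePair T T') (hS : T * S = 1)
    (hS' : T' * S' = 1) : IsTransposePair S S' :=
  isTransposePair_of_rightInverse h hS hS'

omit [Fintype Y] in
/-- **Dirichlet sandwich**: for a symmetric pair (T, Tᵗ) and weights χ, χ′ the operator M_χTM_χ + M_{χ′} has
transpose M_χTᵗM_χ + M_{χ′}; with χ = 1_{Ω₀(□̃)}, χ′ = 1 − χ this is the cell's model of print's Ω₀Δ′_aΩ₀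
(p. 394) made invertible on all of X → ℝ (identity off Ω₀(□̃)). [folklore] -/
theorem isTransposePair_sandwich {T T' : Module.End ℝ (X → ℝ)} (h : IsTransposePair T T') (χ χ' : X → ℝ) :
    IsTransposePair (mulOp χ * T * mulOp χ + mulOp χ') (mulOp χ * T' * mulOp χ + mulOp χ') :=
  (((isTransposePair_mulOp χ).mul h).mul (isTransposePair_mulOp χ)).add (isTransposePair_mulOp χ')

omit [Fintype Y] in
/-- **`hGt` discharged from the symmetry of Δ′_a**: if Δ′ is symmetric, then every (right) inverse G of its
Dirichlet sandwich M_χΔ′M_χ + M_{χ′} (print: Ω₀Δ′_aΩ₀, Ω₀ = Ω₀(□̃)) is symmetric — `IsTransposePair G G`, the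
literal shape of `hGt`. [cite: Balaban1985BackgroundPropagators, p.394 (Ω₀Δ′_aΩ₀, G′) + p.409 (G′_□)] -/
theorem isTransposePair_dirichletInverse {Δ G : Module.End ℝ (X → ℝ)} (hΔ : IsTransposePair Δ Δ) (χ χ' : X → ℝ)
    (hG : (mulOp χ * Δ * mulOp χ + mulOp χ') * G = 1) : IsTransposePair G G :=
  isTransposePair_inv (isTransposePair_sandwich hΔ χ χ') hG hG

end Transpose

/-! ## §6 (v2) The inputs h342_1 … h342_4 of §3, family form, FROM Corollary 3.6 AS TYPED -/

section FromCor36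

variable [Fintype St] [DecidableEq St] [Fintype Bd] [DecidableEq Bd] [Fintype Cp] [DecidableEq Cp]

/-- **h342_1 ∧ h342_2 ∧ h342_3 ∧ h342_4 for the whole family {G′_□ᵢ}ᵢ with ONE pair (B₀, δ₀), from Corollary 3.6 AS
TYPED.**  Print, p. 409 (verbatim, render p021-x2): *"the sequence {Ω_n(□)} satisfies the assumptions of Corollary 3.6.
The operators constructed for this sequence, which we denote by G′_□(U), C_□(U) = (Q′(U)G′_□²(U)Q′*(U))^{−1}, G_□(U),
satisfy all the inequalities of Theorems 3.1–3.3 correspondingly."*  Typed: `B9.Cor36Printed` for the family of the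
G′-kernel families `Gp i` of the cubes □ᵢ (index ι, one geometry g, one background class B) yields a₁, M₁, B₀, δ₀ > 0
such that — for M ≧ M₁, 0 < α₀ with O(1)Mα₀ ≦ a₁, U satisfying (3.35), every cube in the class of (3.35) (`InCube`) —
the model operators `Gsq i` = G′_□ᵢ and their covariant derivatives `covD ∘ₗ Gsq i`, `Gsq i ∘ₗ covDT`,
`(covDT ∘ₗ covD) ∘ₗ Gsq i`, READ by the quantities e₀, e₁, e₂, e₃ of `Gp i` (r1-g11's `Realizes`, hypotheses), satisfy
EXACTLY the binders `h342_1`, `h342_2`, `h342_3`, `h342_4` of `thm37_entry{4,2,1,3}_of_342_lattice_of_387_sz`.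
Corollary 3.6 NOT asserted (hypothesis `h36`); via `B9Thm37GlueCor36.h342_of_cor36_joint`.
[cite: Balaban1985BackgroundPropagators, Cor. 3.6 p.408 + p.409; (3.42) p.397] -/
theorem h342_family_of_cor36 {ι : Type} {B : B9.Backgrounds} {dC : ℕ} {c35 : ℝ} {InCube : ι → Prop}
    {Gp GA : ι → B9.KernelFamily g B} {Cinv : ι → B9.SiteKernel g B}
    (h36 : B9.Cor36Printed dC c35 (fun _ : ι => g) (fun _ : ι => B) InCube Gp GA Cinv)
    (hlen : ∀ y : g.Site, 0 ≤ g.len y) :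
    ∃ a₁ M₁ B₀ δ₀ : ℝ, 0 < a₁ ∧ 0 < M₁ ∧ 0 < B₀ ∧ 0 < δ₀ ∧
      (M₁ ≤ g.M → ∀ α₀ : ℝ, 0 < α₀ → c35 * g.M * α₀ ≤ a₁ → ∀ U : B.Cfg, B.Reg335 c35 α₀ U →
        (∀ i, InCube i) →
        ∀ (src tgt : Bd → St) (c : Bd → ℝ) (Rm : Bd → Cp → Cp → ℝ) (blk : St × Cp → g.Site)
          (blkY : Bd × Cp → g.Site) (Gsq : ι → Module.End ℝ (St × Cp → ℝ)),
          (∀ i, B9SectCDiffDict.Realizes (Gp i) 0 U blk blk (LinearMap.toMatrix' (Gsq i))) →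
          (∀ i, B9SectCDiffDict.Realizes (Gp i) 1 U blkY blk
            (LinearMap.toMatrix' (covD src tgt c Rm ∘ₗ Gsq i))) →
          (∀ i, B9SectCDiffDict.Realizes (Gp i) 2 U blk blkY
            (LinearMap.toMatrix' (Gsq i ∘ₗ covDT src tgt c Rm))) →
          (∀ i, B9SectCDiffDict.Realizes (Gp i) 3 U blk blk
            (LinearMap.toMatrix' ((covDT src tgt c Rm ∘ₗ covD src tgt c Rm) ∘ₗ Gsq i))) →
          (∀ i, HasMajorant (g := toB6 g R H) blk (Gsq i)
              (fun a b => B₀ * g.len a ^ 2 * Real.exp (-(δ₀ * g.dist a b)))) ∧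
          (∀ i, HasMajorantHom (g := toB6 g R H) blk blkY (covD src tgt c Rm ∘ₗ Gsq i)
              (fun a b => B₀ * g.len a * Real.exp (-(δ₀ * g.dist a b)))) ∧
          (∀ i, HasMajorantHom (g := toB6 g R H) blkY blk (Gsq i ∘ₗ covDT src tgt c Rm)
              (fun a b => B₀ * g.len a * Real.exp (-(δ₀ * g.dist a b)))) ∧
          (∀ i, HasMajorantHom (g := toB6 g R H) blk blk ((covDT src tgt c Rm ∘ₗ covD src tgt c Rm) ∘ₗ Gsq i)
              (fun a b => B₀ * Real.exp (-(δ₀ * g.dist a b))))) := by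
  obtain ⟨a₁, M₁, B₀, δ₀, ha₁, hM₁, hB₀, hδ₀, hall⟩ :=
    B9Thm37GlueCor36.h342_of_cor36_joint (R := R) (H := H) h36 hlen
  refine ⟨a₁, M₁, B₀, δ₀, ha₁, hM₁, hB₀, hδ₀, ?_⟩
  intro hM α₀ hα hsmall U hU hIn src tgt c Rm blk blkY Gsq h0 h1 h2 h3
  refine ⟨fun i => ?_, fun i => ?_, fun i => ?_, fun i => ?_⟩ <;>
    obtain ⟨k₀, k₁, k₂, k₃⟩ := hall i (hIn i) hM α₀ hα hsmall U hU (St × Cp) (Bd × Cp) blk blkY (Gsq i)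
      (covD src tgt c Rm ∘ₗ Gsq i) (Gsq i ∘ₗ covDT src tgt c Rm)
      ((covDT src tgt c Rm ∘ₗ covD src tgt c Rm) ∘ₗ Gsq i) (h0 i) (h1 i) (h2 i) (h3 i)
  · exact k₀
  · exact k₁
  · exact k₂
  · exact k₃

end FromCor36

end Literature.MathematicalPhysics.QuantumFieldTheory.Balaban1983to89.B9Thm37GlueSz
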